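import Literature.NumberTheory.LFunctions.ProlateSupNormRate
import HarnessLib

/-!
# Connes' Fact 6.4 = CCM25 Lemma 7.3 with its printed rate `O(λ^{−1/2−Re s})`

Connes–Consani–Moscovici 2025 (arXiv:2511.22755), proof of Lemma 7.3 (p. 32), derive from the
sup-norm prolate → Hermite rate `δ(λ) ≤ cλ^{-2}` (their (7.8)) the estimate
`|𝓜(k_λ)(s) − ∫ k u^{s-1}| ≤ 2cλ^{−1/2−α}(1−2α)^{-1}`, `α = Re s`, i.e. the convergence of Fact 6.4
of Connes' 2026 Letter at the rate `O(λ^{−1/2−α})` on every line of the strip, uniformly on closed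
substrips.  The tree so far had the QUALITATIVE statement (`prolateGuess_tendsto_riemannXi`, proved
unconditionally in `ConnesProlateGuessRHFree` and again in `ProlateSupNormRate`).  THIS file proves
the quantitative form, unconditionally and with every constant explicit in the proof:

* `prolateGuess_rate : ∀ α₀ ∈ [0, ½), ∃ C Λ, ∀ λ ≥ Λ, ∀ prolate h_{0,λ}, h_{4,λ}, ∀ s, |Re s| ≤ α₀ →
  ‖4M_λ(s) − ξ(½+s)‖ ≤ C·λ^{−(½+Re s)}` (the printed per-line rate),
* `prolateGuess_rate_uniform : … ≤ C·λ^{−(½−α₀)}` (the uniform rate on the closed substrip),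
* the closing `example : prolateGuess_tendsto_riemannXi` (a third unconditional proof of the landed
  qualitative theorem, hence an `example`, not a declaration).

The new analytic input is the weighted `W^{1,1}` RATE for the prolate functions,
`w11Rate_zero/four : λ|h_{n,λ}(λ)|, ∫_0^λ|h_{n,λ} − h_n|, ∫_0^λ|h_{n,λ}′ − h_n′|(1+x) = O(λ^{-2})`
(`n = 0, 4`), obtained from the sup-norm rate `prolateSupNormRate_zero/four` and the eigenvalue bounds
`|χ_n(λ) − μλ²| ≤ D` of `ProlateSupNormRate` by the engine `w11Rate_of_supNormRate`:
1. on the fixed window `[0, X]`, `X = μ + D + 6`, Gronwall (`IsProlateFunction.window_compare`) gives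
   `|f − ch|, |f′ − ch′| ≤ A₁λ^{-2}` with `c = f(0)/h(0)`, and `|c − 1| = O(λ^{-2})` by the sup-norm
   rate at `x = 0`;
2. on the forbidden region `[X, λ]` the error `e = f − ch` solves `((λ²−x²)e′)′ = ((2πλx)² − χ)e + ρ`
   with `(2πλx)² − χ ≥ 6λ²` and `|ρ| ≤ Re^{−2x}` (exponential decay of the Hermite data,
   `abs_q_hermiteH0/H4_le_exp`); a maximum principle WITHOUT boundary condition at the singular end
   point `x = λ` (`le_zero_of_sturm_noBC`, using only `(λ²−x²)e′ → 0`) and the explicit barrier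
   `β = (m/λ²)e^{−2x}` give `|e(x)| ≤ (m/λ²)e^{−2x}` on `[X, λ]` (`forbidden_region_barrier`);
3. integrating the equation from the end point, `|(λ²−x²)e′(x)| ≤ A(e^{−x} − e^{−λ})`, whence
   `|e′| ≤ (4A/3λ²)e^{−x}` on `[X, λ/2]` and `|e′| ≤ (A/λ)e^{−x}` on `(X, λ)`; the weighted
   integrals are then `O(λ^{-2})` (`forbidden_region_integrals`), and so is `λ|f(λ)|` (the barrier
   at `x = λ`).
The rest is bookkeeping already used for the qualitative theorem: the ratio `ρ_λ → ρ` at rate `λ^{-2}`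
(`prolateGuessRatio_rate`), the guess `h_λ = A(h_{4,λ} − ρ_λh_{0,λ})` (`prolateGuessH_rate`), the
Gaussian tail `∫_λ^∞|h′|x^c ≤ T₀/(2λ²)` and the explicit Mellin-side bound
`norm_four_mul_prolateGuessMellin_sub_riemannXi_le_explicit_of_even` (Müntz's formula in the strip,
Titchmarsh's bound for `ζ(w)/w`), whose boundary term carries exactly the factor `λ^{−(Re s+½)}`.
THIS IS NOT AN RH STATEMENT; nothing here uses or approaches RH (the Letter's Part II / the
`θ_λ ≈ k_λ` step are not touched).
-/

noncomputable section

open Real Set MeasureTheory Filter Topology intervalIntegral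

namespace Literature.NumberTheory.LFunctions

/-! ### A maximum principle with no boundary condition at the singular end point -/

/-- **One-sided maximum principle without a condition at `b`.**  If `u` is continuous on `[a, b]`,
differentiable inside with `P = p·u′`, `p > 0`, `P′ = V u + σ` with `V > 0`, `σ ≥ 0` on `(a, b)`,
`P(y) → 0` as `y → b⁻` and `u(a) ≤ 0`, then `u ≤ 0` on `[a, b]`: at an interior positive maximum
`P = 0 < P′`, so `u′ > 0` just to the right; at a positive maximum at `b`, `P` is increasing near `b`
with limit `0`, so `P < 0`, `u′ < 0` and `u` decreases towards `b`. [folklore] -/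
theorem le_zero_of_sturm_noBC {u u' P p V σ : ℝ → ℝ} {a b : ℝ} (hab : a < b)
    (huc : ContinuousOn u (Icc a b)) (hud : ∀ x ∈ Ioo a b, HasDerivAt u (u' x) x)
    (hP : ∀ x ∈ Ioo a b, P x = p x * u' x) (hp : ∀ x ∈ Ioo a b, 0 < p x)
    (hPd : ∀ x ∈ Ioo a b, HasDerivAt P (V x * u x + σ x) x)
    (hV : ∀ x ∈ Ioo a b, 0 < V x) (hσ : ∀ x ∈ Ioo a b, 0 ≤ σ x)
    (hPb : Tendsto P (𝓝[<] b) (𝓝 0)) (hua : u a ≤ 0) :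
    ∀ x ∈ Icc a b, u x ≤ 0 := by
  obtain ⟨xs, hxs, hmax⟩ := isCompact_Icc.exists_isMaxOn (nonempty_Icc.2 hab.le) huc
  intro x hx
  refine (hmax hx).trans ?_
  by_contra hcon
  rw [not_le] at hcon
  have hxa : a < xs := by
    rcases eq_or_lt_of_le hxs.1 with h | h
    · rw [← h] at hcon; exact absurd hua (not_le.2 hcon)
    · exact h
  rcases eq_or_lt_of_le hxs.2 with hxb | hxb
  · -- the maximum is attained at `b = xs`
    obtain ⟨δ, hδ, hδu⟩ := Metric.continuousWithinAt_iff.1 (huc xs hxs) (u xs) hcon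
    obtain ⟨z₀, hz₀def⟩ : ∃ z₀ : ℝ, z₀ = max a (xs - δ / 2) := ⟨_, rfl⟩
    have hz₀a : a ≤ z₀ := by rw [hz₀def]; exact le_max_left _ _
    have hz₀b : z₀ < xs := by rw [hz₀def]; exact max_lt hxa (by linarith)
    have hIoo : Ioo z₀ xs ⊆ Ioo a b := fun z hz ↦
      ⟨lt_of_le_of_lt hz₀a hz.1, by rw [← hxb]; exact hz.2⟩
    have hupos : ∀ z ∈ Ioo z₀ xs, 0 < u z := by
      intro z hz
      have hz1 : xs - δ / 2 < z := lt_of_le_of_lt (le_max_right a _) (by rw [← hz₀def]; exact hz.1)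
      have hzI : z ∈ Icc a b := ⟨hz₀a.trans hz.1.le, by rw [← hxb]; exact hz.2.le⟩
      have hd : dist z xs < δ := by
        rw [Real.dist_eq, abs_sub_lt_iff]; constructor <;> linarith [hz.2]
      have h := hδu hzI hd
      rw [Real.dist_eq, abs_sub_lt_iff] at h
      linarith [h.2]
    -- `P` is strictly increasing on `(z₀, b)`, hence negative there
    have hPmono : StrictMonoOn P (Ioo z₀ xs) := by
      refine strictMonoOn_of_deriv_pos (convex_Ioo z₀ xs)
        (fun z hz ↦ (hPd z (hIoo hz)).continuousAt.continuousWithinAt) ?_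
      intro z hz
      rw [interior_Ioo] at hz
      rw [(hPd z (hIoo hz)).deriv]
      have h1 := mul_pos (hV z (hIoo hz)) (hupos z hz)
      linarith [hσ z (hIoo hz)]
    have hPb' : Tendsto P (𝓝[<] xs) (𝓝 0) := by rw [hxb]; exact hPb
    have hPneg : ∀ z ∈ Ioo z₀ xs, P z < 0 := by
      intro z hz
      obtain ⟨z', hzz', hz'b⟩ := exists_between hz.2
      have hz'I : z' ∈ Ioo z₀ xs := ⟨hz.1.trans hzz', hz'b⟩
      have h1 : P z < P z' := hPmono hz hz'I hzz'
      have h2 : P z' ≤ 0 := by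
        refine ge_of_tendsto hPb' ?_
        filter_upwards [Ioo_mem_nhdsLT hz'b] with w hw
        exact (hPmono hz'I ⟨hz'I.1.trans hw.1, hw.2⟩ hw.1).le
      linarith
    -- so `u′ < 0` there and `u` is strictly decreasing on `[z₁, b]`
    obtain ⟨z₁, hz₁a, hz₁b⟩ := exists_between hz₀b
    have hanti : StrictAntiOn u (Icc z₁ xs) := by
      refine strictAntiOn_of_deriv_neg (convex_Icc z₁ xs)
        (huc.mono (Icc_subset_Icc (hz₀a.trans hz₁a.le) hxs.2)) ?_
      intro z hz
      rw [interior_Icc] at hz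
      have hzI : z ∈ Ioo z₀ xs := ⟨hz₁a.trans hz.1, hz.2⟩
      rw [(hud z (hIoo hzI)).deriv]
      have h1 := hPneg z hzI
      rw [hP z (hIoo hzI)] at h1
      have h2 := hp z (hIoo hzI)
      by_contra h3
      rw [not_lt] at h3
      nlinarith
    have hlt : u xs < u z₁ := hanti ⟨le_rfl, hz₁b.le⟩ ⟨hz₁b.le, le_rfl⟩ hz₁b
    have := hmax (show z₁ ∈ Icc a b from ⟨hz₀a.trans hz₁a.le, by rw [← hxb]; exact hz₁b.le⟩)
    exact absurd hlt (not_lt.2 this)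
  · -- interior maximum
    have hxI : xs ∈ Ioo a b := ⟨hxa, hxb⟩
    have hloc : IsLocalMax u xs := hmax.isLocalMax (Icc_mem_nhds hxa hxb)
    have hu'0 : u' xs = 0 := hloc.hasDerivAt_eq_zero (hud xs hxI)
    have hP0 : P xs = 0 := by rw [hP xs hxI, hu'0, mul_zero]
    have hd : 0 < V xs * u xs + σ xs := by
      have := mul_pos (hV xs hxI) hcon
      linarith [hσ xs hxI]
    have hslope : ∀ᶠ y in 𝓝[≠] xs, 0 < slope P xs y :=
      ((hPd xs hxI).tendsto_slope).eventually (lt_mem_nhds hd)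
    have hslope' : ∀ᶠ y in 𝓝[>] xs, 0 < slope P xs y :=
      hslope.filter_mono (nhdsWithin_mono _ fun y hy ↦ ne_of_gt (mem_Ioi.1 hy))
    obtain ⟨v, hv, hsub⟩ := mem_nhdsGT_iff_exists_Ioo_subset.1 hslope'
    obtain ⟨y, hy1, hy2⟩ := exists_between (lt_min (mem_Ioi.1 hv) hxb)
    have hyv : y < v := lt_of_lt_of_le hy2 (min_le_left _ _)
    have hyb : y < b := lt_of_lt_of_le hy2 (min_le_right _ _)
    have hpos : ∀ z ∈ Ioo xs y, 0 < u' z := by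
      intro z hz
      have hzI : z ∈ Ioo a b := ⟨hxa.trans hz.1, hz.2.trans hyb⟩
      have hs : 0 < slope P xs z := hsub ⟨hz.1, hz.2.trans hyv⟩
      rw [slope_def_field, hP0, sub_zero] at hs
      have hPz : 0 < P z := by
        have hzx : 0 < z - xs := by linarith [hz.1]
        by_contra hcon'
        have : P z / (z - xs) ≤ 0 := div_nonpos_of_nonpos_of_nonneg (not_lt.1 hcon') hzx.le
        linarith
      rw [hP z hzI] at hPz
      by_contra hcon'
      rw [not_lt] at hcon'
      nlinarith [hp z hzI, hcon']
    have hcy : ContinuousOn u (Icc xs y) := huc.mono (Icc_subset_Icc hxa.le hyb.le)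
    have hdy : ∀ z ∈ Ioo xs y, HasDerivAt u (u' z) z := fun z hz ↦
      hud z ⟨hxa.trans hz.1, hz.2.trans hyb⟩
    obtain ⟨c, hc, hce⟩ := exists_hasDerivAt_eq_slope u u' hy1 hcy hdy
    have hgt : u xs < u y := by
      have h := hpos c hc
      rw [hce] at h
      have hyx : 0 < y - xs := by linarith
      rcases div_pos_iff.1 h with ⟨hnum, _⟩ | ⟨_, hden⟩
      · linarith
      · linarith
    have := hmax (show y ∈ Icc a b from ⟨(hxa.trans hy1).le, hyb.le⟩)
    exact absurd hgt (not_lt.2 this)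

/-- **Comparison with a barrier.**  Let `e` satisfy `(p e′)′ = V e + ρ` on `(a, b)` in the sense of
`le_zero_of_sturm_noBC` (`P = p e′ → 0` at `b⁻`), and let `β` be a barrier: `(p β′)′ = V β + κ`
with `Q = p β′ → 0` at `b⁻` and `κ + |ρ| ≤ 0` on `(a, b)`.  If `|e(a)| ≤ β(a)` then `|e| ≤ β` on
`[a, b]` (apply the one-sided principle to `e − β` and `−e − β`). [folklore] -/
theorem abs_le_barrier_of_sturm {e e' P p V ρ β β' Q κ : ℝ → ℝ} {a b : ℝ} (hab : a < b)
    (hec : ContinuousOn e (Icc a b)) (hed : ∀ x ∈ Ioo a b, HasDerivAt e (e' x) x)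
    (hP : ∀ x ∈ Ioo a b, P x = p x * e' x) (hp : ∀ x ∈ Ioo a b, 0 < p x)
    (hPd : ∀ x ∈ Ioo a b, HasDerivAt P (V x * e x + ρ x) x) (hV : ∀ x ∈ Ioo a b, 0 < V x)
    (hPb : Tendsto P (𝓝[<] b) (𝓝 0))
    (hβc : ContinuousOn β (Icc a b)) (hβd : ∀ x ∈ Ioo a b, HasDerivAt β (β' x) x)
    (hQ : ∀ x ∈ Ioo a b, Q x = p x * β' x)
    (hQd : ∀ x ∈ Ioo a b, HasDerivAt Q (V x * β x + κ x) x)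
    (hQb : Tendsto Q (𝓝[<] b) (𝓝 0))
    (hκ : ∀ x ∈ Ioo a b, κ x + |ρ x| ≤ 0) (hea : |e a| ≤ β a) :
    ∀ x ∈ Icc a b, |e x| ≤ β x := by
  intro x hx
  have hlim : Tendsto (fun y ↦ P y - Q y) (𝓝[<] b) (𝓝 0) := by simpa using hPb.sub hQb
  have hlim' : Tendsto (fun y ↦ -P y - Q y) (𝓝[<] b) (𝓝 0) := by simpa using hPb.neg.sub hQb
  have h1 := le_zero_of_sturm_noBC hab (u := fun y ↦ e y - β y) (u' := fun y ↦ e' y - β' y)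
    (P := fun y ↦ P y - Q y) (p := p) (V := V) (σ := fun y ↦ ρ y - κ y)
    (hec.sub hβc) (fun y hy ↦ (hed y hy).sub (hβd y hy))
    (fun y hy ↦ by simp only [hP y hy, hQ y hy]; ring) hp
    (fun y hy ↦ ((hPd y hy).sub (hQd y hy)).congr_deriv (by ring)) hV
    (fun y hy ↦ by have := hκ y hy; have := neg_abs_le (ρ y); linarith) hlim
    (by have := le_abs_self (e a); linarith) x hx
  have h2 := le_zero_of_sturm_noBC hab (u := fun y ↦ -e y - β y) (u' := fun y ↦ -e' y - β' y)
    (P := fun y ↦ -P y - Q y) (p := p) (V := V) (σ := fun y ↦ -ρ y - κ y)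
    (hec.neg.sub hβc) (fun y hy ↦ (hed y hy).neg.sub (hβd y hy))
    (fun y hy ↦ by simp only [hP y hy, hQ y hy]; ring) hp
    (fun y hy ↦ ((hPd y hy).neg.sub (hQd y hy)).congr_deriv (by ring)) hV
    (fun y hy ↦ by have := hκ y hy; have := le_abs_self (ρ y); linarith) hlim'
    (by have := neg_abs_le (e a); linarith) x hx
  rw [abs_le]; constructor <;> linarith

/-! ### Decay of `P = p e′` from the decay of `P′` -/

/-- If `P′ = F` on `(X, λ)` with `|F(t)| ≤ A e^{−t}`, `F` continuous, and `P(y) → 0` as `y → λ⁻`,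
then `|P(x)| ≤ A(e^{−x} − e^{−λ})` for `x ∈ (X, λ)` (`P(x) = −∫_x^λ F`). [folklore] -/
theorem abs_le_of_hasDerivAt_of_tendsto {P F : ℝ → ℝ} {X lam A : ℝ}
    (hPd : ∀ t ∈ Ioo X lam, HasDerivAt P (F t) t) (hFc : ContinuousOn F (Ioo X lam))
    (hF : ∀ t ∈ Ioo X lam, |F t| ≤ A * Real.exp (-t))
    (hPl : Tendsto P (𝓝[<] lam) (𝓝 0)) {x : ℝ} (hx : x ∈ Ioo X lam) :
    |P x| ≤ A * (Real.exp (-x) - Real.exp (-lam)) := by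
  have hA : 0 ≤ A := by
    have h := hF x hx
    have he := Real.exp_pos (-x)
    by_contra hA
    rw [not_le] at hA
    have : A * Real.exp (-x) < 0 := mul_neg_of_neg_of_pos hA he
    linarith [abs_nonneg (P x), abs_nonneg (F x)]
  have key : ∀ y ∈ Ioo x lam, |P x| ≤ |P y| + A * (Real.exp (-x) - Real.exp (-lam)) := by
    intro y hy
    have hxy : x ≤ y := hy.1.le
    have hsub : Icc x y ⊆ Ioo X lam := fun t ht ↦ ⟨hx.1.trans_le ht.1, lt_of_le_of_lt ht.2 hy.2⟩
    have hFi : IntervalIntegrable F volume x y :=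
      ((hFc.mono hsub).mono (by rw [uIcc_of_le hxy])).intervalIntegrable
    have hftc : ∫ t in x..y, F t = P y - P x :=
      intervalIntegral.integral_eq_sub_of_hasDerivAt
        (fun t ht ↦ hPd t (hsub (by rwa [uIcc_of_le hxy] at ht))) hFi
    have hexp : ∫ t in x..y, A * Real.exp (-t) = A * (Real.exp (-x) - Real.exp (-y)) := by
      have hd : ∀ t ∈ uIcc x y, HasDerivAt (fun t ↦ -A * Real.exp (-t)) (A * Real.exp (-t)) t := by
        intro t _
        have := ((hasDerivAt_neg t).exp.const_mul (-A))
        refine this.congr_deriv ?_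
        ring
      rw [intervalIntegral.integral_eq_sub_of_hasDerivAt hd
        ((by fun_prop : Continuous fun t ↦ A * Real.exp (-t)).intervalIntegrable _ _)]
      ring
    have h1 : |P y - P x| ≤ A * (Real.exp (-x) - Real.exp (-y)) := by
      rw [← hftc, ← hexp]
      calc |∫ t in x..y, F t| ≤ ∫ t in x..y, |F t| :=
            intervalIntegral.abs_integral_le_integral_abs hxy
        _ ≤ ∫ t in x..y, A * Real.exp (-t) :=
            intervalIntegral.integral_mono_on hxy hFi.abs
              ((by fun_prop : Continuous fun t ↦ A * Real.exp (-t)).intervalIntegrable _ _)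
              (fun t ht ↦ hF t (hsub ht))
    have h2 : Real.exp (-lam) ≤ Real.exp (-y) := Real.exp_le_exp.2 (by linarith [hy.2])
    have h3 := abs_sub_abs_le_abs_sub (P x) (P y)
    rw [abs_sub_comm] at h3
    nlinarith [mul_le_mul_of_nonneg_left h2 hA]
  have hlim : Tendsto (fun y ↦ |P y| + A * (Real.exp (-x) - Real.exp (-lam))) (𝓝[<] lam)
      (𝓝 (0 + A * (Real.exp (-x) - Real.exp (-lam)))) := by
    have h := hPl.abs
    rw [abs_zero] at h
    exact h.add tendsto_const_nhds
  rw [zero_add] at hlim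
  exact ge_of_tendsto hlim (by filter_upwards [Ioo_mem_nhdsLT hx.2] with y hy using key y hy)


/-! ### Exponential decay of the Hermite data -/

/-- `e^{−πx²} ≤ e·e^{−(π/2)x²}·e^{−2x}` for every real `x` (`(π/2)x² − 2x + 1 ≥ 0`). [folklore] -/
theorem exp_neg_pi_mul_sq_le (x : ℝ) :
    Real.exp (-(π * x ^ 2)) ≤ Real.exp 1 * Real.exp (-(π / 2 * x ^ 2)) * Real.exp (-(2 * x)) := by
  rw [← Real.exp_add, ← Real.exp_add, Real.exp_le_exp]
  have h1 : 0 ≤ (π - 3) * x ^ 2 := mul_nonneg (by linarith [Real.pi_gt_three]) (sq_nonneg x)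
  nlinarith [sq_nonneg (x - 1), sq_nonneg x]

/-- `|h_0(x)| ≤ 2^{1/4}e·e^{−2x}`. [folklore] -/
theorem abs_hermiteH0_le_exp (x : ℝ) :
    |hermiteH0 x| ≤ (2 : ℝ) ^ ((1 : ℝ) / 4) * Real.exp 1 * Real.exp (-(2 * x)) := by
  rw [abs_of_pos (hermiteH0_pos x)]
  unfold hermiteH0
  have hee : Real.exp (-π * x ^ 2) = Real.exp (-(π * x ^ 2)) := by ring_nf
  rw [hee]
  have h2 : 0 ≤ (2 : ℝ) ^ ((1 : ℝ) / 4) := (Real.rpow_pos_of_pos two_pos _).le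
  have hg : Real.exp (-(π / 2 * x ^ 2)) ≤ 1 := by
    rw [Real.exp_le_one_iff]; nlinarith [Real.pi_pos, sq_nonneg x]
  have hm := exp_neg_pi_mul_sq_le x
  have he1 := Real.exp_pos (1 : ℝ)
  have he2 := Real.exp_pos (-(2 * x))
  calc (2 : ℝ) ^ ((1 : ℝ) / 4) * Real.exp (-(π * x ^ 2))
      ≤ (2 : ℝ) ^ ((1 : ℝ) / 4) * (Real.exp 1 * Real.exp (-(π / 2 * x ^ 2)) * Real.exp (-(2 * x))) :=
        mul_le_mul_of_nonneg_left hm h2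
    _ ≤ (2 : ℝ) ^ ((1 : ℝ) / 4) * (Real.exp 1 * 1 * Real.exp (-(2 * x))) := by gcongr
    _ = (2 : ℝ) ^ ((1 : ℝ) / 4) * Real.exp 1 * Real.exp (-(2 * x)) := by ring

/-- `|(x²h_0′)′(x)| ≤ 44·2^{1/4}e·e^{−2x}` (`(x²h_0′)′ = 2^{1/4}(16y² − 12y)e^{−πx²}`, `y = πx²/2`,
`e^{−πx²} ≤ e·e^{−y}e^{−2x}`, `y^k e^{−y} ≤ k!`). [folklore] -/
theorem abs_q_hermiteH0_le_exp (x : ℝ) :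
    |2 * x * hermiteH0' x + x ^ 2 * ((4 * π ^ 2 * x ^ 2 - 2 * π) * hermiteH0 x)|
      ≤ 44 * (2 : ℝ) ^ ((1 : ℝ) / 4) * Real.exp 1 * Real.exp (-(2 * x)) := by
  have h2 : 0 ≤ (2 : ℝ) ^ ((1 : ℝ) / 4) := (Real.rpow_pos_of_pos two_pos _).le
  have hy : 0 ≤ π / 2 * x ^ 2 := by positivity
  obtain ⟨h1, h1'⟩ := mul_exp_neg_le hy
  have hee : Real.exp (-π * x ^ 2) = Real.exp (-(π * x ^ 2)) := by ring_nf
  have he := Real.exp_pos (-(π * x ^ 2))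
  have e : 2 * x * hermiteH0' x + x ^ 2 * ((4 * π ^ 2 * x ^ 2 - 2 * π) * hermiteH0 x)
      = (2 : ℝ) ^ ((1 : ℝ) / 4)
        * ((16 * (π / 2 * x ^ 2) ^ 2 - 12 * (π / 2 * x ^ 2)) * Real.exp (-(π * x ^ 2))) := by
    simp only [hermiteH0, hermiteH0', hee]; ring
  rw [e, abs_mul, abs_of_nonneg h2, abs_mul, abs_of_pos he]
  have hP : |16 * (π / 2 * x ^ 2) ^ 2 - 12 * (π / 2 * x ^ 2)|
      ≤ 16 * (π / 2 * x ^ 2) ^ 2 + 12 * (π / 2 * x ^ 2) := by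
    rw [abs_le]; constructor <;> nlinarith [sq_nonneg (π / 2 * x ^ 2)]
  have hm := exp_neg_pi_mul_sq_le x
  have hE := Real.exp_pos (1 : ℝ)
  have hE2 := Real.exp_pos (-(2 * x))
  calc (2 : ℝ) ^ ((1 : ℝ) / 4) * (|16 * (π / 2 * x ^ 2) ^ 2 - 12 * (π / 2 * x ^ 2)|
        * Real.exp (-(π * x ^ 2)))
      ≤ (2 : ℝ) ^ ((1 : ℝ) / 4) * ((16 * (π / 2 * x ^ 2) ^ 2 + 12 * (π / 2 * x ^ 2))
        * (Real.exp 1 * Real.exp (-(π / 2 * x ^ 2)) * Real.exp (-(2 * x)))) :=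
        mul_le_mul_of_nonneg_left (mul_le_mul hP hm he.le (by positivity)) h2
    _ = (2 : ℝ) ^ ((1 : ℝ) / 4) * (Real.exp 1 * Real.exp (-(2 * x)))
        * (16 * ((π / 2 * x ^ 2) ^ 2 * Real.exp (-(π / 2 * x ^ 2)))
          + 12 * ((π / 2 * x ^ 2) * Real.exp (-(π / 2 * x ^ 2)))) := by ring
    _ ≤ (2 : ℝ) ^ ((1 : ℝ) / 4) * (Real.exp 1 * Real.exp (-(2 * x))) * (16 * 2 + 12 * 1) := by
        gcongr
    _ = 44 * (2 : ℝ) ^ ((1 : ℝ) / 4) * Real.exp 1 * Real.exp (-(2 * x)) := by ring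

/-- `|h_4(x)| ≤ 179e/(16A)·e^{−2x}` (`|64y² − 48y + 3|e^{−y} ≤ 179`, `y = πx²/2`). [folklore] -/
theorem abs_hermiteH4_le_exp (x : ℝ) :
    |hermiteH4 x| ≤ 179 * Real.exp 1 / (16 * prolateGuessA) * Real.exp (-(2 * x)) := by
  have hA := prolateGuessA_pos
  have hy : 0 ≤ π / 2 * x ^ 2 := by positivity
  obtain ⟨h1, h1'⟩ := mul_exp_neg_le hy
  have hee : Real.exp (-π * x ^ 2) = Real.exp (-(π * x ^ 2)) := by ring_nf
  have he := Real.exp_pos (-(π * x ^ 2))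
  have hm := exp_neg_pi_mul_sq_le x
  have hE := Real.exp_pos (1 : ℝ)
  have hE2 := Real.exp_pos (-(2 * x))
  have e : hermiteH4 x = (64 * (π / 2 * x ^ 2) ^ 2 - 48 * (π / 2 * x ^ 2) + 3)
      * Real.exp (-(π * x ^ 2)) / (16 * prolateGuessA) := by
    simp only [hermiteH4, hee]; ring
  rw [e, abs_div, abs_of_pos (by positivity : (0 : ℝ) < 16 * prolateGuessA), abs_mul,
    abs_of_pos he, show 179 * Real.exp 1 / (16 * prolateGuessA) * Real.exp (-(2 * x))
      = 179 * Real.exp 1 * Real.exp (-(2 * x)) / (16 * prolateGuessA) by ring,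
    div_le_div_iff_of_pos_right (by positivity)]
  have hP : |64 * (π / 2 * x ^ 2) ^ 2 - 48 * (π / 2 * x ^ 2) + 3|
      ≤ 64 * (π / 2 * x ^ 2) ^ 2 + 48 * (π / 2 * x ^ 2) + 3 := by
    rw [abs_le]; constructor <;> nlinarith [sq_nonneg (π / 2 * x ^ 2)]
  have hg : Real.exp (-(π / 2 * x ^ 2)) ≤ 1 := by
    rw [Real.exp_le_one_iff]; nlinarith [Real.pi_pos, sq_nonneg x]
  calc |64 * (π / 2 * x ^ 2) ^ 2 - 48 * (π / 2 * x ^ 2) + 3| * Real.exp (-(π * x ^ 2))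
      ≤ (64 * (π / 2 * x ^ 2) ^ 2 + 48 * (π / 2 * x ^ 2) + 3)
        * (Real.exp 1 * Real.exp (-(π / 2 * x ^ 2)) * Real.exp (-(2 * x))) :=
        mul_le_mul hP hm he.le (by positivity)
    _ = Real.exp 1 * Real.exp (-(2 * x)) * (64 * ((π / 2 * x ^ 2) ^ 2 * Real.exp (-(π / 2 * x ^ 2)))
          + 48 * ((π / 2 * x ^ 2) * Real.exp (-(π / 2 * x ^ 2)))
          + 3 * Real.exp (-(π / 2 * x ^ 2))) := by ring
    _ ≤ Real.exp 1 * Real.exp (-(2 * x)) * (64 * 2 + 48 * 1 + 3 * 1) := by gcongr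
    _ = 179 * Real.exp 1 * Real.exp (-(2 * x)) := by ring

/-- `|(x²h_4′)′(x)| ≤ 51748e/(16A)·e^{−2x}` (`(x²h_4′)′ = (1024y⁴ − 3584y³ + 2672y² − 324y)e^{−πx²}/(16A)`,
`y = πx²/2`). [folklore] -/
theorem abs_q_hermiteH4_le_exp (x : ℝ) :
    |2 * x * hermiteH4' x + x ^ 2 * ((4 * π ^ 2 * x ^ 2 - 18 * π) * hermiteH4 x)|
      ≤ 51748 * Real.exp 1 / (16 * prolateGuessA) * Real.exp (-(2 * x)) := by
  have hA := prolateGuessA_pos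
  have hy : 0 ≤ π / 2 * x ^ 2 := by positivity
  obtain ⟨h1, h2⟩ := mul_exp_neg_le hy
  obtain ⟨h3, h4⟩ := cube_mul_exp_neg_le hy
  have hee : Real.exp (-π * x ^ 2) = Real.exp (-(π * x ^ 2)) := by ring_nf
  have he := Real.exp_pos (-(π * x ^ 2))
  have hm := exp_neg_pi_mul_sq_le x
  have hE := Real.exp_pos (1 : ℝ)
  have hE2 := Real.exp_pos (-(2 * x))
  have e : 2 * x * hermiteH4' x + x ^ 2 * ((4 * π ^ 2 * x ^ 2 - 18 * π) * hermiteH4 x)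
      = (1024 * (π / 2 * x ^ 2) ^ 4 - 3584 * (π / 2 * x ^ 2) ^ 3 + 2672 * (π / 2 * x ^ 2) ^ 2
          - 324 * (π / 2 * x ^ 2)) * Real.exp (-(π * x ^ 2)) / (16 * prolateGuessA) := by
    simp only [hermiteH4, hermiteH4', hee]; ring
  rw [e, abs_div, abs_of_pos (by positivity : (0 : ℝ) < 16 * prolateGuessA), abs_mul,
    abs_of_pos he, show 51748 * Real.exp 1 / (16 * prolateGuessA) * Real.exp (-(2 * x))
      = 51748 * Real.exp 1 * Real.exp (-(2 * x)) / (16 * prolateGuessA) by ring,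
    div_le_div_iff_of_pos_right (by positivity)]
  have p3 : 0 ≤ (π / 2 * x ^ 2) ^ 3 := by positivity
  have p4 : 0 ≤ (π / 2 * x ^ 2) ^ 4 := by positivity
  have hP : |1024 * (π / 2 * x ^ 2) ^ 4 - 3584 * (π / 2 * x ^ 2) ^ 3 + 2672 * (π / 2 * x ^ 2) ^ 2
        - 324 * (π / 2 * x ^ 2)|
      ≤ 1024 * (π / 2 * x ^ 2) ^ 4 + 3584 * (π / 2 * x ^ 2) ^ 3 + 2672 * (π / 2 * x ^ 2) ^ 2
        + 324 * (π / 2 * x ^ 2) := by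
    rw [abs_le]; constructor <;> nlinarith [sq_nonneg (π / 2 * x ^ 2)]
  calc |1024 * (π / 2 * x ^ 2) ^ 4 - 3584 * (π / 2 * x ^ 2) ^ 3 + 2672 * (π / 2 * x ^ 2) ^ 2
          - 324 * (π / 2 * x ^ 2)| * Real.exp (-(π * x ^ 2))
      ≤ (1024 * (π / 2 * x ^ 2) ^ 4 + 3584 * (π / 2 * x ^ 2) ^ 3 + 2672 * (π / 2 * x ^ 2) ^ 2
          + 324 * (π / 2 * x ^ 2))
        * (Real.exp 1 * Real.exp (-(π / 2 * x ^ 2)) * Real.exp (-(2 * x))) :=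
        mul_le_mul hP hm he.le (by positivity)
    _ = Real.exp 1 * Real.exp (-(2 * x))
        * (1024 * ((π / 2 * x ^ 2) ^ 4 * Real.exp (-(π / 2 * x ^ 2)))
          + 3584 * ((π / 2 * x ^ 2) ^ 3 * Real.exp (-(π / 2 * x ^ 2)))
          + 2672 * ((π / 2 * x ^ 2) ^ 2 * Real.exp (-(π / 2 * x ^ 2)))
          + 324 * ((π / 2 * x ^ 2) * Real.exp (-(π / 2 * x ^ 2)))) := by ring
    _ ≤ Real.exp 1 * Real.exp (-(2 * x)) * (1024 * 24 + 3584 * 6 + 2672 * 2 + 324 * 1) := by gcongr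
    _ = 51748 * Real.exp 1 * Real.exp (-(2 * x)) := by ring

/-! ### The weighted `W^{1,1}` rate: a barrier on the forbidden region -/

/-- `∫_a^b e^{−2x}dx = (e^{−2a} − e^{−2b})/2`. [folklore] -/
theorem integral_exp_neg_two_mul (a b : ℝ) :
    ∫ x in a..b, Real.exp (-(2 * x)) = (Real.exp (-(2 * a)) - Real.exp (-(2 * b))) / 2 := by
  have hd : ∀ x ∈ uIcc a b,
      HasDerivAt (fun y ↦ -(1 / 2) * Real.exp (-(2 * y))) (Real.exp (-(2 * x))) x := by
    intro x _
    have h2 : HasDerivAt (fun y : ℝ ↦ -(2 * y)) (-2) x := by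
      simpa using (hasDerivAt_id' x).const_mul (-2 : ℝ)
    refine (h2.exp.const_mul (-(1 / 2))).congr_deriv ?_
    ring
  rw [intervalIntegral.integral_eq_sub_of_hasDerivAt hd
    ((by fun_prop : Continuous fun y ↦ Real.exp (-(2 * y))).intervalIntegrable _ _)]
  ring

/-- `∫_a^b e^{−x/2}dx = 2(e^{−a/2} − e^{−b/2})`. [folklore] -/
theorem integral_exp_neg_half_mul (a b : ℝ) :
    ∫ x in a..b, Real.exp (-(x / 2)) = 2 * (Real.exp (-(a / 2)) - Real.exp (-(b / 2))) := by
  have hd : ∀ x ∈ uIcc a b,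
      HasDerivAt (fun y ↦ -2 * Real.exp (-(y / 2))) (Real.exp (-(x / 2))) x := by
    intro x _
    have h2 : HasDerivAt (fun y : ℝ ↦ -(y / 2)) (-(1 / 2)) x := by
      have h := (hasDerivAt_id' x).const_mul (-(1 / 2) : ℝ)
      have e : (fun y : ℝ ↦ -(1 / 2) * y) = fun y ↦ -(y / 2) := by funext y; ring
      rw [e] at h
      exact h.congr_deriv (by ring)
    refine (h2.exp.const_mul (-2)).congr_deriv ?_
    ring
  rw [intervalIntegral.integral_eq_sub_of_hasDerivAt hd
    ((by fun_prop : Continuous fun y ↦ Real.exp (-(y / 2))).intervalIntegrable _ _)]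
  ring

set_option maxHeartbeats 800000 in
/-- **Barrier on the forbidden region.**  Let `f ∈ PW_λ` be prolate with eigenvalue `χ ≥ 0`, `h`
solve `h″ = (4π²x² − μ)h`, `c > 0`, and suppose on `(X, λ)` the potential is large,
`(2πλx)² − χ ≥ 6λ²` (`λ ≥ 1`), the source `ρ = c((λ²μ − χ)h + (x²h′)′)` of the defect equation
`((λ² − x²)e′)′ = ((2πλx)² − χ)e + ρ` for `e = f − ch` satisfies `|ρ| ≤ Re^{−2x}`, `R ≤ m`, and
`|e(X)| ≤ mλ^{-2}e^{−2X}`.  Then `|e| ≤ mλ^{-2}e^{−2x}` on `[X, λ]` (`abs_le_barrier_of_sturm` with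
the barrier `β = mλ^{-2}e^{−2x}`: `((λ²−x²)β′)′ − Vβ ≤ −λ²β ≤ −|ρ|`; NO condition at the singular end
point beyond `(λ² − x²)e′ → 0`), and with `A = 8π²m + R`: `|((λ²−x²)e′)′| ≤ Ae^{−x}`, so
`|e′(x)| ≤ (4A/3)λ^{-2}e^{−x}` for `x ≤ λ/2` and `|e′(x)| ≤ Aλ^{-1}e^{−x}` on `(X, λ)`
(`abs_le_of_hasDerivAt_of_tendsto`). [folklore] -/
theorem forbidden_region_barrier {lam : ℝ} {n : ℕ} {f : ℝ → ℝ} (hf : IsProlateFunction lam n f)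
    (hlam1 : 1 ≤ lam) {χ : ℝ}
    (hχ : ∀ x ∈ Ioo (-lam) lam, -(deriv (fun y ↦ (lam ^ 2 - y ^ 2) * deriv f y) x)
      + (2 * π * lam * x) ^ 2 * f x = χ * f x) (hχ0 : 0 ≤ χ)
    {μ : ℝ} {h h' : ℝ → ℝ} (hh : ∀ x, HasDerivAt h (h' x) x)
    (hh' : ∀ x, HasDerivAt h' ((4 * π ^ 2 * x ^ 2 - μ) * h x) x)
    {c : ℝ} (hc0 : 0 < c) {X : ℝ} (hX0 : 0 ≤ X) (hXl : X < lam)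
    (hV6 : ∀ x ∈ Ioo X lam, 6 * lam ^ 2 ≤ (2 * π * lam * x) ^ 2 - χ)
    {R m A : ℝ} (hR0 : 0 ≤ R) (hRm : R ≤ m) (hAdef : A = 8 * π ^ 2 * m + R)
    (hρ : ∀ x, |c * ((lam ^ 2 * μ - χ) * h x
      + (2 * x * h' x + x ^ 2 * ((4 * π ^ 2 * x ^ 2 - μ) * h x)))| ≤ R * Real.exp (-(2 * x)))
    (hea : |f X - c * h X| ≤ m / lam ^ 2 * Real.exp (-(2 * X))) :
    (∀ x ∈ Icc X lam, |f x - c * h x| ≤ m / lam ^ 2 * Real.exp (-(2 * x))) ∧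
    (∀ x ∈ Ioo X lam, x ≤ lam / 2 →
      |deriv f x - c * h' x| ≤ 4 * A / (3 * lam ^ 2) * Real.exp (-x)) ∧
    (∀ x ∈ Ioo X lam, |deriv f x - c * h' x| ≤ A / lam * Real.exp (-x)) := by
  have hlam0 := hf.lam_pos
  have hl2 : 0 < lam ^ 2 := by positivity
  have hl1sq : 1 ≤ lam ^ 2 := by nlinarith
  have hm0 : 0 ≤ m := hR0.trans hRm
  have hA0 : 0 ≤ A := by rw [hAdef]; positivity
  have hhc : Continuous h := continuous_iff_continuousAt.2 fun y ↦ (hh y).continuousAt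
  have hh'c : Continuous h' := continuous_iff_continuousAt.2 fun y ↦ (hh' y).continuousAt
  -- `e = f − c h`, `P = (λ² − x²)e′`
  have hec : ContinuousOn (fun x ↦ f x - c * h x) (Icc X lam) :=
    (hf.contDiffOn.continuousOn.mono (Icc_subset_Icc (by linarith) le_rfl)).sub
      (continuousOn_const.mul hhc.continuousOn)
  have hed : ∀ x ∈ Ioo X lam, HasDerivAt (fun x ↦ f x - c * h x) (deriv f x - c * h' x) x :=
    fun x hx ↦ ((hf.differentiableAt ⟨by linarith [hx.1], hx.2⟩).hasDerivAt).sub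
      ((hh x).const_mul c)
  have hPp : ∀ x ∈ Ioo X lam, (lam ^ 2 - x ^ 2) * deriv f x - c * ((lam ^ 2 - x ^ 2) * h' x)
      = (lam ^ 2 - x ^ 2) * (deriv f x - c * h' x) := fun x _ ↦ by ring
  have hp : ∀ x ∈ Ioo X lam, 0 < lam ^ 2 - x ^ 2 := fun x hx ↦ by nlinarith [hx.1, hx.2]
  have hPd : ∀ x ∈ Ioo X lam, HasDerivAt
      (fun y ↦ (lam ^ 2 - y ^ 2) * deriv f y - c * ((lam ^ 2 - y ^ 2) * h' y))
      (((2 * π * lam * x) ^ 2 - χ) * (f x - c * h x)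
        + c * ((lam ^ 2 * μ - χ) * h x
          + (2 * x * h' x + x ^ 2 * ((4 * π ^ 2 * x ^ 2 - μ) * h x)))) x := by
    intro x hx
    have hxI : x ∈ Ioo (-lam) lam := ⟨by linarith [hx.1], hx.2⟩
    have h1 := hf.hasDerivAt_sqMulDeriv hχ hxI
    have hp2 : HasDerivAt (fun y : ℝ ↦ lam ^ 2 - y ^ 2) (-(2 * x)) x := by
      simpa using (hasDerivAt_pow 2 x).const_sub (lam ^ 2)
    have h2 := hp2.mul (hh' x)
    have h3 := h1.sub (h2.const_mul c)
    refine h3.congr_deriv ?_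
    ring
  -- `P → 0` at `λ⁻`: `f′`, `h′` are bounded and `λ² − x² → 0`
  have hPl : Tendsto (fun y ↦ (lam ^ 2 - y ^ 2) * deriv f y - c * ((lam ^ 2 - y ^ 2) * h' y))
      (𝓝[<] lam) (𝓝 0) := by
    obtain ⟨Bf, hBf⟩ := hf.exists_bound_deriv
    obtain ⟨Bh, hBh⟩ := isCompact_Icc.exists_bound_of_continuousOn
      (hh'c.continuousOn : ContinuousOn h' (Icc 0 lam))
    have hg : Tendsto (fun y : ℝ ↦ (lam ^ 2 - y ^ 2) * (Bf + c * Bh)) (𝓝[<] lam) (𝓝 0) := by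
      have h1 : Tendsto (fun y : ℝ ↦ (lam ^ 2 - y ^ 2) * (Bf + c * Bh)) (𝓝 lam)
          (𝓝 ((lam ^ 2 - lam ^ 2) * (Bf + c * Bh))) :=
        (by fun_prop : Continuous fun y : ℝ ↦ (lam ^ 2 - y ^ 2) * (Bf + c * Bh)).tendsto lam
      rw [sub_self, zero_mul] at h1
      exact h1.mono_left nhdsWithin_le_nhds
    refine squeeze_zero_norm' ?_ hg
    filter_upwards [Ioo_mem_nhdsLT hXl] with y hy
    have hyI : y ∈ Ioo (-lam) lam := ⟨by linarith [hy.1], hy.2⟩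
    rw [Real.norm_eq_abs, hPp y hy, abs_mul, abs_of_pos (hp y hy)]
    refine mul_le_mul_of_nonneg_left ?_ (hp y hy).le
    have hb : |h' y| ≤ Bh := by
      simpa [Real.norm_eq_abs] using hBh y ⟨by linarith [hy.1], hy.2.le⟩
    calc |deriv f y - c * h' y| ≤ |deriv f y| + |c * h' y| := abs_sub _ _
      _ ≤ Bf + c * Bh := by
          rw [abs_mul, abs_of_pos hc0]
          exact add_le_add (hBf y hyI).2 (mul_le_mul_of_nonneg_left hb hc0.le)
  -- the barrier `β = mλ^{-2}e^{−2x}`, `Q = (λ² − x²)β′`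
  have hβd : ∀ x, HasDerivAt (fun y ↦ m / lam ^ 2 * Real.exp (-(2 * y)))
      (-2 * (m / lam ^ 2 * Real.exp (-(2 * x)))) x := by
    intro x
    have h2 : HasDerivAt (fun y : ℝ ↦ -(2 * y)) (-2) x := by
      simpa using (hasDerivAt_id' x).const_mul (-2 : ℝ)
    refine (h2.exp.const_mul (m / lam ^ 2)).congr_deriv ?_
    ring
  have hQd : ∀ x ∈ Ioo X lam, HasDerivAt
      (fun y ↦ (lam ^ 2 - y ^ 2) * (-2 * (m / lam ^ 2 * Real.exp (-(2 * y)))))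
      (((2 * π * lam * x) ^ 2 - χ) * (m / lam ^ 2 * Real.exp (-(2 * x)))
        + (m / lam ^ 2 * Real.exp (-(2 * x)))
          * (4 * x + 4 * (lam ^ 2 - x ^ 2) - ((2 * π * lam * x) ^ 2 - χ))) x := by
    intro x _
    have hp2 : HasDerivAt (fun y : ℝ ↦ lam ^ 2 - y ^ 2) (-(2 * x)) x := by
      simpa using (hasDerivAt_pow 2 x).const_sub (lam ^ 2)
    have h2 := hp2.mul ((hβd x).const_mul (-2))
    refine h2.congr_deriv ?_
    ring
  have hQl : Tendsto (fun y ↦ (lam ^ 2 - y ^ 2) * (-2 * (m / lam ^ 2 * Real.exp (-(2 * y)))))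
      (𝓝[<] lam) (𝓝 0) := by
    have h1 : Tendsto (fun y ↦ (lam ^ 2 - y ^ 2) * (-2 * (m / lam ^ 2 * Real.exp (-(2 * y)))))
        (𝓝 lam) (𝓝 ((lam ^ 2 - lam ^ 2) * (-2 * (m / lam ^ 2 * Real.exp (-(2 * lam)))))) :=
      (by fun_prop : Continuous fun y ↦
        (lam ^ 2 - y ^ 2) * (-2 * (m / lam ^ 2 * Real.exp (-(2 * y))))).tendsto lam
    rw [sub_self, zero_mul] at h1
    exact h1.mono_left nhdsWithin_le_nhds
  have hκ : ∀ x ∈ Ioo X lam, (m / lam ^ 2 * Real.exp (-(2 * x)))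
      * (4 * x + 4 * (lam ^ 2 - x ^ 2) - ((2 * π * lam * x) ^ 2 - χ))
      + |c * ((lam ^ 2 * μ - χ) * h x
          + (2 * x * h' x + x ^ 2 * ((4 * π ^ 2 * x ^ 2 - μ) * h x)))| ≤ 0 := by
    intro x hx
    have hβ0 : 0 ≤ m / lam ^ 2 * Real.exp (-(2 * x)) := by positivity
    have h1 : 4 * x + 4 * (lam ^ 2 - x ^ 2) - ((2 * π * lam * x) ^ 2 - χ) ≤ -lam ^ 2 := by
      have := hV6 x hx
      nlinarith [sq_nonneg (2 * x - 1)]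
    have h2 := mul_le_mul_of_nonneg_left h1 hβ0
    have h3 : m / lam ^ 2 * Real.exp (-(2 * x)) * -lam ^ 2 = -(m * Real.exp (-(2 * x))) := by
      rw [show m / lam ^ 2 * Real.exp (-(2 * x)) * -lam ^ 2
          = -(m * Real.exp (-(2 * x))) * (lam ^ 2 / lam ^ 2) by ring, div_self hl2.ne', mul_one]
    have h4 := (hρ x).trans (mul_le_mul_of_nonneg_right hRm (Real.exp_pos _).le)
    linarith
  -- the barrier bound `|e| ≤ mλ^{-2}e^{−2x}` on `[X, λ]`
  have hE : ∀ x ∈ Icc X lam, |f x - c * h x| ≤ m / lam ^ 2 * Real.exp (-(2 * x)) :=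
    abs_le_barrier_of_sturm hXl (e := fun x ↦ f x - c * h x)
      (e' := fun x ↦ deriv f x - c * h' x)
      (P := fun y ↦ (lam ^ 2 - y ^ 2) * deriv f y - c * ((lam ^ 2 - y ^ 2) * h' y))
      (p := fun x ↦ lam ^ 2 - x ^ 2) (V := fun x ↦ (2 * π * lam * x) ^ 2 - χ)
      (ρ := fun x ↦ c * ((lam ^ 2 * μ - χ) * h x
        + (2 * x * h' x + x ^ 2 * ((4 * π ^ 2 * x ^ 2 - μ) * h x))))
      (β := fun y ↦ m / lam ^ 2 * Real.exp (-(2 * y)))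
      (β' := fun y ↦ -2 * (m / lam ^ 2 * Real.exp (-(2 * y))))
      (Q := fun y ↦ (lam ^ 2 - y ^ 2) * (-2 * (m / lam ^ 2 * Real.exp (-(2 * y)))))
      (κ := fun x ↦ (m / lam ^ 2 * Real.exp (-(2 * x)))
        * (4 * x + 4 * (lam ^ 2 - x ^ 2) - ((2 * π * lam * x) ^ 2 - χ)))
      hec hed hPp hp hPd (fun x hx ↦ by linarith [hV6 x hx, hl2]) hPl
      ((by fun_prop : Continuous fun y ↦ m / lam ^ 2 * Real.exp (-(2 * y))).continuousOn)
      (fun x _ ↦ hβd x) (fun x _ ↦ rfl) hQd hQl hκ hea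
  -- `|P′| = |V e + ρ| ≤ A e^{−x}` on `(X, λ)`
  have hF : ∀ x ∈ Ioo X lam, |((2 * π * lam * x) ^ 2 - χ) * (f x - c * h x)
      + c * ((lam ^ 2 * μ - χ) * h x
          + (2 * x * h' x + x ^ 2 * ((4 * π ^ 2 * x ^ 2 - μ) * h x)))| ≤ A * Real.exp (-x) := by
    intro x hx
    have hx0 : 0 ≤ x := by linarith [hx.1]
    have hVle : (2 * π * lam * x) ^ 2 - χ ≤ 4 * π ^ 2 * lam ^ 2 * x ^ 2 := by
      have : (2 * π * lam * x) ^ 2 = 4 * π ^ 2 * lam ^ 2 * x ^ 2 := by ring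
      linarith
    have hV0 : 0 ≤ (2 * π * lam * x) ^ 2 - χ := by linarith [hV6 x hx, hl2]
    have he := hE x ⟨hx.1.le, hx.2.le⟩
    have hexx : Real.exp (-(2 * x)) = Real.exp (-x) * Real.exp (-x) := by
      rw [← Real.exp_add]; ring_nf
    have hx2e : x ^ 2 * Real.exp (-x) ≤ 2 := (mul_exp_neg_le hx0).2
    have hex1 : Real.exp (-x) ≤ 1 := by rw [Real.exp_le_one_iff]; linarith
    have hex0 := Real.exp_pos (-x)
    have hm4 : 0 ≤ 4 * π ^ 2 * m := by positivity
    calc |((2 * π * lam * x) ^ 2 - χ) * (f x - c * h x)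
          + c * ((lam ^ 2 * μ - χ) * h x
            + (2 * x * h' x + x ^ 2 * ((4 * π ^ 2 * x ^ 2 - μ) * h x)))|
        ≤ |((2 * π * lam * x) ^ 2 - χ) * (f x - c * h x)|
          + |c * ((lam ^ 2 * μ - χ) * h x
            + (2 * x * h' x + x ^ 2 * ((4 * π ^ 2 * x ^ 2 - μ) * h x)))| := abs_add_le _ _
      _ ≤ (4 * π ^ 2 * lam ^ 2 * x ^ 2) * (m / lam ^ 2 * Real.exp (-(2 * x)))
          + R * Real.exp (-(2 * x)) := by
          rw [abs_mul, abs_of_nonneg hV0]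
          exact add_le_add (mul_le_mul hVle he (abs_nonneg _) (by positivity)) (hρ x)
      _ = (4 * π ^ 2 * m * (x ^ 2 * Real.exp (-x)) + R * Real.exp (-x)) * Real.exp (-x) := by
          rw [hexx, show (4 * π ^ 2 * lam ^ 2 * x ^ 2) * (m / lam ^ 2 * (Real.exp (-x) * Real.exp (-x)))
            = 4 * π ^ 2 * m * (x ^ 2 * Real.exp (-x)) * Real.exp (-x) * (lam ^ 2 / lam ^ 2) by ring,
            div_self hl2.ne']
          ring
      _ ≤ (4 * π ^ 2 * m * 2 + R * 1) * Real.exp (-x) := by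
          refine mul_le_mul_of_nonneg_right ?_ hex0.le
          exact add_le_add (mul_le_mul_of_nonneg_left hx2e hm4)
            (mul_le_mul_of_nonneg_left hex1 hR0)
      _ = A * Real.exp (-x) := by rw [hAdef]; ring
  -- `|P(x)| ≤ A(e^{−x} − e^{−λ})` on `(X, λ)`
  have hFc : ContinuousOn (fun x ↦ ((2 * π * lam * x) ^ 2 - χ) * (f x - c * h x)
      + c * ((lam ^ 2 * μ - χ) * h x
          + (2 * x * h' x + x ^ 2 * ((4 * π ^ 2 * x ^ 2 - μ) * h x)))) (Ioo X lam) :=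
    ((by fun_prop : Continuous fun x : ℝ ↦ (2 * π * lam * x) ^ 2 - χ).continuousOn.mul
      (hec.mono Ioo_subset_Icc_self)).add
      (by fun_prop : Continuous fun x : ℝ ↦ c * ((lam ^ 2 * μ - χ) * h x
          + (2 * x * h' x + x ^ 2 * ((4 * π ^ 2 * x ^ 2 - μ) * h x)))).continuousOn
  have hPb : ∀ x ∈ Ioo X lam,
      |(lam ^ 2 - x ^ 2) * deriv f x - c * ((lam ^ 2 - x ^ 2) * h' x)|
        ≤ A * (Real.exp (-x) - Real.exp (-lam)) := fun x hx ↦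
    abs_le_of_hasDerivAt_of_tendsto
      (P := fun y ↦ (lam ^ 2 - y ^ 2) * deriv f y - c * ((lam ^ 2 - y ^ 2) * h' y)) hPd hFc hF
      hPl hx
  -- two bounds for `e′` on `(X, λ)`
  refine ⟨hE, fun x hx hx2 ↦ ?_, fun x hx ↦ ?_⟩
  · have hpx := hp x hx
    have hx0 : 0 ≤ x := by linarith [hx.1]
    have h1 := hPb x hx
    rw [hPp x hx, abs_mul, abs_of_pos hpx] at h1
    have h2 : A * (Real.exp (-x) - Real.exp (-lam)) ≤ A * Real.exp (-x) := by
      have := Real.exp_pos (-lam); nlinarith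
    have h3 : 3 * lam ^ 2 / 4 ≤ lam ^ 2 - x ^ 2 := by
      have := pow_le_pow_left₀ hx0 hx2 2
      nlinarith
    have h4 := mul_le_mul_of_nonneg_left h3 (abs_nonneg (deriv f x - c * h' x))
    rw [show 4 * A / (3 * lam ^ 2) * Real.exp (-x) = 4 * (A * Real.exp (-x)) / (3 * lam ^ 2) by
      ring, le_div_iff₀ (by positivity : (0 : ℝ) < 3 * lam ^ 2)]
    linarith [h1.trans h2]
  · have hpx := hp x hx
    have h1 := hPb x hx
    rw [hPp x hx, abs_mul, abs_of_pos hpx] at h1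
    have h2 : Real.exp (-x) - Real.exp (-lam) ≤ (lam - x) * Real.exp (-x) := by
      have h := Real.add_one_le_exp (-(lam - x))
      have h' : Real.exp (-lam) = Real.exp (-(lam - x)) * Real.exp (-x) := by
        rw [← Real.exp_add]; ring_nf
      rw [h']
      nlinarith [Real.exp_pos (-x)]
    have h3 : (lam ^ 2 - x ^ 2) * |deriv f x - c * h' x| ≤ A * ((lam - x) * Real.exp (-x)) :=
      h1.trans (mul_le_mul_of_nonneg_left h2 hA0)
    have hlx : 0 < lam - x := by linarith [hx.2]
    have h4 : (lam + x) * |deriv f x - c * h' x| ≤ A * Real.exp (-x) := by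
      have e1 : (lam ^ 2 - x ^ 2) * |deriv f x - c * h' x|
          = (lam - x) * ((lam + x) * |deriv f x - c * h' x|) := by ring
      rw [e1, show A * ((lam - x) * Real.exp (-x)) = (lam - x) * (A * Real.exp (-x)) by ring] at h3
      exact le_of_mul_le_mul_left h3 hlx
    rw [show A / lam * Real.exp (-x) = A * Real.exp (-x) / lam by ring, le_div_iff₀ hlam0]
    have hx0 : 0 ≤ x := by linarith [hx.1]
    nlinarith [abs_nonneg (deriv f x - c * h' x)]

set_option maxHeartbeats 800000 in
/-- **The five integrals.**  From the window bounds `|e|, |e′| ≤ A₁λ^{-2}` on `[0, X]`, the barrier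
bound `|e| ≤ mλ^{-2}e^{−2x}` on `[X, λ]` and the two derivative bounds of
`forbidden_region_barrier`: `∫_0^λ|e| ≤ (XA₁ + m)λ^{-2}` and
`∫_0^λ|e′|(1+x) ≤ (X(1+X)A₁ + 56A)λ^{-2}` (`∫_X^{λ/2}`: `(1+x)e^{−x} ≤ 3e^{−x/2}`;
`∫_{λ/2}^λ`: `λ³e^{−λ/2} ≤ 48`). [folklore] -/
theorem forbidden_region_integrals {lam : ℝ} {n : ℕ} {f : ℝ → ℝ} (hf : IsProlateFunction lam n f)
    {h h' : ℝ → ℝ} (hhc : Continuous h) (hh'c : Continuous h') {c X A₁ m A : ℝ}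
    (hlam1 : 1 ≤ lam) (hX0 : 0 ≤ X) (hXl2 : X ≤ lam / 2) (hA0 : 0 ≤ A)
    (hwin : ∀ x ∈ Icc 0 X, |f x - c * h x| ≤ A₁ / lam ^ 2 ∧
      |deriv f x - c * h' x| ≤ A₁ / lam ^ 2)
    (hE : ∀ x ∈ Icc X lam, |f x - c * h x| ≤ m / lam ^ 2 * Real.exp (-(2 * x)))
    (he'1 : ∀ x ∈ Ioo X lam, x ≤ lam / 2 →
      |deriv f x - c * h' x| ≤ 4 * A / (3 * lam ^ 2) * Real.exp (-x))
    (he'2 : ∀ x ∈ Ioo X lam, |deriv f x - c * h' x| ≤ A / lam * Real.exp (-x)) :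
    (∫ x in (0 : ℝ)..lam, |f x - c * h x|) ≤ (X * A₁ + m) / lam ^ 2 ∧
    (∫ x in (0 : ℝ)..lam, |deriv f x - c * h' x| * (1 + x))
      ≤ (X * ((1 + X) * A₁) + 56 * A) / lam ^ 2 := by
  have hlam0 := hf.lam_pos
  have hl2 : 0 < lam ^ 2 := by positivity
  have hXl : X < lam := by linarith
  have hm0 : 0 ≤ m := by
    have h1 := (abs_nonneg _).trans (hE lam ⟨hXl.le, le_rfl⟩)
    have h2 := Real.exp_pos (-(2 * lam))
    by_contra hneg
    rw [not_le] at hneg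
    have : m / lam ^ 2 * Real.exp (-(2 * lam)) < 0 :=
      mul_neg_of_neg_of_pos (div_neg_of_neg_of_pos hneg hl2) h2
    linarith
  have hA₁0 : 0 ≤ A₁ := by
    have h1 := (abs_nonneg _).trans (hwin 0 ⟨le_rfl, hX0⟩).1
    by_contra hneg
    rw [not_le] at hneg
    have : A₁ / lam ^ 2 < 0 := div_neg_of_neg_of_pos hneg hl2
    linarith
  -- integrability on `[0, λ]`
  have hcf : ContinuousOn f (Icc 0 lam) :=
    hf.contDiffOn.continuousOn.mono (Icc_subset_Icc (by linarith) le_rfl)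
  have hecont : ContinuousOn (fun x ↦ f x - c * h x) (Icc 0 lam) :=
    hcf.sub (continuousOn_const.mul hhc.continuousOn)
  have hu : uIcc 0 lam = Icc 0 lam := uIcc_of_le hlam0.le
  have ie0 : IntervalIntegrable (fun x ↦ |f x - c * h x|) volume 0 lam :=
    ((hecont.abs).mono hu.le).intervalIntegrable
  have ie' : IntervalIntegrable (fun x ↦ |deriv f x - c * h' x| * (1 + x)) volume 0 lam :=
    ((hf.intervalIntegrable_deriv.sub ((hh'c.intervalIntegrable _ _).const_mul c)).abs).mul_continuousOn
      (by fun_prop)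
  have hsub0X : uIcc 0 X ⊆ uIcc 0 lam := by
    rw [uIcc_of_le hX0, hu]; exact Icc_subset_Icc le_rfl hXl.le
  have hsubXl : uIcc X lam ⊆ uIcc 0 lam := by
    rw [uIcc_of_le hXl.le, hu]; exact Icc_subset_Icc hX0 le_rfl
  have hsubX2 : uIcc X (lam / 2) ⊆ uIcc 0 lam := by
    rw [uIcc_of_le hXl2, hu]; exact Icc_subset_Icc hX0 (by linarith)
  have hsub2l : uIcc (lam / 2) lam ⊆ uIcc 0 lam := by
    rw [uIcc_of_le (by linarith : lam / 2 ≤ lam), hu]; exact Icc_subset_Icc (by linarith) le_rfl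
  -- (1) `∫_0^X |e| ≤ X A₁λ^{-2}`, `∫_X^λ |e| ≤ mλ^{-2}`
  have I1 : (∫ x in (0 : ℝ)..X, |f x - c * h x|) ≤ X * (A₁ / lam ^ 2) := by
    calc (∫ x in (0 : ℝ)..X, |f x - c * h x|) ≤ ∫ x in (0 : ℝ)..X, A₁ / lam ^ 2 :=
          intervalIntegral.integral_mono_on hX0 (ie0.mono_set hsub0X) intervalIntegrable_const
            (fun x hx ↦ (hwin x hx).1)
      _ = X * (A₁ / lam ^ 2) := by rw [intervalIntegral.integral_const, smul_eq_mul]; ring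
  have I2 : (∫ x in X..lam, |f x - c * h x|) ≤ m / lam ^ 2 := by
    calc (∫ x in X..lam, |f x - c * h x|) ≤ ∫ x in X..lam, m / lam ^ 2 * Real.exp (-(2 * x)) :=
          intervalIntegral.integral_mono_on hXl.le (ie0.mono_set hsubXl)
            ((by fun_prop : Continuous fun y ↦ m / lam ^ 2 * Real.exp (-(2 * y))).intervalIntegrable
              _ _) (fun x hx ↦ hE x hx)
      _ = m / lam ^ 2 * ((Real.exp (-(2 * X)) - Real.exp (-(2 * lam))) / 2) := by
          rw [intervalIntegral.integral_const_mul, integral_exp_neg_two_mul]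
      _ ≤ m / lam ^ 2 * 1 := by
          refine mul_le_mul_of_nonneg_left ?_ (by positivity)
          have := Real.exp_pos (-(2 * lam))
          have : Real.exp (-(2 * X)) ≤ 1 := by rw [Real.exp_le_one_iff]; linarith
          linarith
      _ = m / lam ^ 2 := mul_one _
  -- (2) `∫_0^X |e′|(1+x)`, `∫_X^{λ/2} |e′|(1+x)`, `∫_{λ/2}^λ |e′|(1+x)`
  have I3 : (∫ x in (0 : ℝ)..X, |deriv f x - c * h' x| * (1 + x))
      ≤ X * ((1 + X) * A₁ / lam ^ 2) := by
    calc (∫ x in (0 : ℝ)..X, |deriv f x - c * h' x| * (1 + x))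
        ≤ ∫ x in (0 : ℝ)..X, (1 + X) * A₁ / lam ^ 2 := by
          refine intervalIntegral.integral_mono_on hX0 (ie'.mono_set hsub0X) intervalIntegrable_const
            (fun x hx ↦ ?_)
          have h1 := (hwin x hx).2
          have h2 : 1 + x ≤ 1 + X := by linarith [hx.2]
          calc |deriv f x - c * h' x| * (1 + x) ≤ A₁ / lam ^ 2 * (1 + X) :=
                mul_le_mul h1 h2 (by linarith [hx.1]) (by positivity)
            _ = (1 + X) * A₁ / lam ^ 2 := by ring
      _ = X * ((1 + X) * A₁ / lam ^ 2) := by rw [intervalIntegral.integral_const, smul_eq_mul]; ring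
  have I4 : (∫ x in X..(lam / 2), |deriv f x - c * h' x| * (1 + x)) ≤ 8 * A / lam ^ 2 := by
    have hpt : ∀ x ∈ Ioo X (lam / 2),
        |deriv f x - c * h' x| * (1 + x) ≤ 4 * A / lam ^ 2 * Real.exp (-(x / 2)) := by
      intro x hx
      have hx0 : 0 ≤ x := by linarith [hx.1]
      have hxI : x ∈ Ioo X lam := ⟨hx.1, by linarith [hx.2]⟩
      have h1 := he'1 x hxI hx.2.le
      have h2 : (1 + x) * Real.exp (-x) ≤ 3 * Real.exp (-(x / 2)) := by
        have hh := (mul_exp_neg_le (by positivity : 0 ≤ x / 2)).1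
        have e1 : Real.exp (-x) = Real.exp (-(x / 2)) * Real.exp (-(x / 2)) := by
          rw [← Real.exp_add]; ring_nf
        rw [e1]
        have := Real.exp_pos (-(x / 2))
        have : Real.exp (-(x / 2)) ≤ 1 := by rw [Real.exp_le_one_iff]; linarith
        nlinarith
      calc |deriv f x - c * h' x| * (1 + x) ≤ 4 * A / (3 * lam ^ 2) * Real.exp (-x) * (1 + x) :=
            mul_le_mul_of_nonneg_right h1 (by linarith)
        _ = 4 * A / (3 * lam ^ 2) * ((1 + x) * Real.exp (-x)) := by ring
        _ ≤ 4 * A / (3 * lam ^ 2) * (3 * Real.exp (-(x / 2))) :=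
            mul_le_mul_of_nonneg_left h2 (by positivity)
        _ = 4 * A / lam ^ 2 * Real.exp (-(x / 2)) := by ring
    calc (∫ x in X..(lam / 2), |deriv f x - c * h' x| * (1 + x))
        ≤ ∫ x in X..(lam / 2), 4 * A / lam ^ 2 * Real.exp (-(x / 2)) :=
          intervalIntegral.integral_mono_on_of_le_Ioo hXl2 (ie'.mono_set hsubX2)
            ((by fun_prop : Continuous fun y ↦ 4 * A / lam ^ 2 * Real.exp (-(y / 2))).intervalIntegrable
              _ _) hpt
      _ = 4 * A / lam ^ 2 * (2 * (Real.exp (-(X / 2)) - Real.exp (-(lam / 2 / 2)))) := by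
          rw [intervalIntegral.integral_const_mul, integral_exp_neg_half_mul]
      _ ≤ 4 * A / lam ^ 2 * (2 * 1) := by
          refine mul_le_mul_of_nonneg_left ?_ (by positivity)
          have := Real.exp_pos (-(lam / 2 / 2))
          have : Real.exp (-(X / 2)) ≤ 1 := by rw [Real.exp_le_one_iff]; linarith
          linarith
      _ = 8 * A / lam ^ 2 := by ring
  have I5 : (∫ x in (lam / 2)..lam, |deriv f x - c * h' x| * (1 + x)) ≤ 48 * A / lam ^ 2 := by
    have hpt : ∀ x ∈ Ioo (lam / 2) lam,
        |deriv f x - c * h' x| * (1 + x) ≤ 2 * A * Real.exp (-(lam / 2)) := by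
      intro x hx
      have hxI : x ∈ Ioo X lam := ⟨by linarith [hx.1], hx.2⟩
      have h1 := he'2 x hxI
      have h2 : Real.exp (-x) ≤ Real.exp (-(lam / 2)) := Real.exp_le_exp.2 (by linarith [hx.1])
      have h3 : 1 + x ≤ 2 * lam := by linarith [hx.2]
      have hex := Real.exp_pos (-(lam / 2))
      calc |deriv f x - c * h' x| * (1 + x) ≤ A / lam * Real.exp (-x) * (1 + x) :=
            mul_le_mul_of_nonneg_right h1 (by linarith [hx.1])
        _ ≤ A / lam * Real.exp (-(lam / 2)) * (2 * lam) :=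
            mul_le_mul (mul_le_mul_of_nonneg_left h2 (by positivity)) h3
              (by linarith [hx.1]) (by positivity)
        _ = 2 * A * Real.exp (-(lam / 2)) * (lam / lam) := by ring
        _ = 2 * A * Real.exp (-(lam / 2)) := by rw [div_self hlam0.ne', mul_one]
    have hy : 0 ≤ lam / 2 := by linarith
    have h3 := (cube_mul_exp_neg_le hy).1
    calc (∫ x in (lam / 2)..lam, |deriv f x - c * h' x| * (1 + x))
        ≤ ∫ x in (lam / 2)..lam, 2 * A * Real.exp (-(lam / 2)) :=
          intervalIntegral.integral_mono_on_of_le_Ioo (by linarith) (ie'.mono_set hsub2l)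
            intervalIntegrable_const hpt
      _ = (lam - lam / 2) * (2 * A * Real.exp (-(lam / 2))) := by
          rw [intervalIntegral.integral_const, smul_eq_mul]
      _ = lam * A * Real.exp (-(lam / 2)) := by ring
      _ = 8 * A / lam ^ 2 * ((lam / 2) ^ 3 * Real.exp (-(lam / 2))) := by
          rw [show 8 * A / lam ^ 2 * ((lam / 2) ^ 3 * Real.exp (-(lam / 2)))
              = lam * A * Real.exp (-(lam / 2)) * (lam ^ 2 / lam ^ 2) by ring, div_self hl2.ne',
            mul_one]
      _ ≤ 8 * A / lam ^ 2 * 6 := mul_le_mul_of_nonneg_left h3 (by positivity)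
      _ = 48 * A / lam ^ 2 := by ring
  -- (3) the totals
  have iX2 : IntervalIntegrable (fun x ↦ |deriv f x - c * h' x| * (1 + x)) volume X (lam / 2) :=
    ie'.mono_set hsubX2
  have i2l : IntervalIntegrable (fun x ↦ |deriv f x - c * h' x| * (1 + x)) volume (lam / 2) lam :=
    ie'.mono_set hsub2l
  have hsplit0 : (∫ x in (0 : ℝ)..lam, |f x - c * h x|)
      = (∫ x in (0 : ℝ)..X, |f x - c * h x|) + ∫ x in X..lam, |f x - c * h x| :=
    (intervalIntegral.integral_add_adjacent_intervals (ie0.mono_set hsub0X)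
      (ie0.mono_set hsubXl)).symm
  have hsplit1 : (∫ x in (0 : ℝ)..lam, |deriv f x - c * h' x| * (1 + x))
      = (∫ x in (0 : ℝ)..X, |deriv f x - c * h' x| * (1 + x))
        + ∫ x in X..lam, |deriv f x - c * h' x| * (1 + x) :=
    (intervalIntegral.integral_add_adjacent_intervals (ie'.mono_set hsub0X)
      (ie'.mono_set hsubXl)).symm
  have hsplit2 : (∫ x in X..lam, |deriv f x - c * h' x| * (1 + x))
      = (∫ x in X..(lam / 2), |deriv f x - c * h' x| * (1 + x))
        + ∫ x in (lam / 2)..lam, |deriv f x - c * h' x| * (1 + x) :=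
    (intervalIntegral.integral_add_adjacent_intervals iX2 i2l).symm
  refine ⟨?_, ?_⟩
  · rw [hsplit0]
    have : X * (A₁ / lam ^ 2) + m / lam ^ 2 = (X * A₁ + m) / lam ^ 2 := by ring
    linarith [I1, I2]
  · rw [hsplit1, hsplit2]
    have : X * ((1 + X) * A₁ / lam ^ 2) + 8 * A / lam ^ 2 + 48 * A / lam ^ 2
        = (X * ((1 + X) * A₁) + 56 * A) / lam ^ 2 := by ring
    linarith [I3, I4, I5]

set_option maxHeartbeats 800000 in
/-- **The weighted `W^{1,1}` rate `O(λ^{-2})` from the sup-norm rate (CCM25 Lemma 7.2(i) ⇒ the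
inputs of Fact 6.4 with a rate).**  Let `h` solve `h″ = (4π²x² − μ)h` (`μ ≥ 1`) with `h(0) > 0`,
`h′(0) = 0`, `|h| ≤ H₁e^{−2x}`, `|(x²h′)′| ≤ Q₁e^{−2x}`, `∫_0^∞|h′|(1+x) < ∞`, and suppose for the
prolate functions `f` with `n` zeros the sup-norm rate `max_{[−λ,λ]}|f − h| ≤ Cλ^{-2}`
(`prolateSupNormRate n h`) and the eigenvalue bound `|χ − μλ²| ≤ D`.  Then, uniformly in `f`,
`λ|f(λ)|, ∫_0^λ|f − h|, ∫_0^λ|f′ − h′|(1+x) ≤ Kλ^{-2}` for `λ ≥ Λ`.  Proof: window `[0, X]` by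
Gronwall (`window_compare`, `X = μ + D + 6`); the forbidden region `[X, λ]` by the barrier
(`forbidden_region_barrier`, which also gives the end-point decay `|f(λ)| ≤ (mλ^{-2} + cH₁)e^{−2λ}`);
the integrals by `forbidden_region_integrals`; the scale `|f(0)/h(0) − 1| ≤ Cλ^{-2}/h(0)` is the
sup-norm rate at `x = 0`. [cite: ConnesConsaniMoscovici2025, Lemma 7.2; SlepianPollak1961, §III] -/
theorem w11Rate_of_supNormRate {n : ℕ} {μ : ℝ} (hμ : 1 ≤ μ) {h h' : ℝ → ℝ}
    (hh : ∀ x, HasDerivAt h (h' x) x)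
    (hh' : ∀ x, HasDerivAt h' ((4 * π ^ 2 * x ^ 2 - μ) * h x) x)
    (hh0 : 0 < h 0) (hh'0 : h' 0 = 0)
    {H₁ : ℝ} (hH : ∀ x, |h x| ≤ H₁ * Real.exp (-(2 * x)))
    {Q₁ : ℝ} (hQ : ∀ x, |2 * x * h' x + x ^ 2 * ((4 * π ^ 2 * x ^ 2 - μ) * h x)|
      ≤ Q₁ * Real.exp (-(2 * x)))
    (Ih' : IntegrableOn (fun x ↦ |h' x| * (1 + x)) (Ioi 0))
    (hS : prolateSupNormRate n h)
    (hD : ∃ D Λ : ℝ, 0 ≤ D ∧ ∀ lam : ℝ, Λ ≤ lam → ∀ (f : ℝ → ℝ) (χ : ℝ),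
      IsProlateFunction lam n f →
      (∀ x ∈ Ioo (-lam) lam, -(deriv (fun y ↦ (lam ^ 2 - y ^ 2) * deriv f y) x)
        + (2 * π * lam * x) ^ 2 * f x = χ * f x) → |χ - lam ^ 2 * μ| ≤ D) :
    ∃ K Λ : ℝ, ∀ lam : ℝ, Λ ≤ lam → ∀ f : ℝ → ℝ, IsProlateFunction lam n f →
      lam * |f lam| ≤ K / lam ^ 2 ∧ (∫ x in (0 : ℝ)..lam, |f x - h x|) ≤ K / lam ^ 2 ∧
      (∫ x in (0 : ℝ)..lam, |deriv f x - h' x| * (1 + x)) ≤ K / lam ^ 2 := by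
  have hhc : Continuous h := continuous_iff_continuousAt.2 fun y ↦ (hh y).continuousAt
  have hh'c : Continuous h' := continuous_iff_continuousAt.2 fun y ↦ (hh' y).continuousAt
  have hH0 : 0 ≤ H₁ := by
    have := hH 0
    simp only [mul_zero, neg_zero, Real.exp_zero, mul_one] at this
    exact (abs_nonneg _).trans this
  have hQ0 : 0 ≤ Q₁ := by
    have := hQ 0
    simp only [mul_zero, zero_mul, neg_zero, Real.exp_zero, mul_one, ne_eq, OfNat.ofNat_ne_zero,
      not_false_eq_true, zero_pow, zero_add, abs_zero] at this
    exact this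
  obtain ⟨CS, ΛS, hCS⟩ := hS
  obtain ⟨D, ΛD, hD0, hD⟩ := hD
  obtain ⟨N', hN'def⟩ : ∃ N' : ℝ, N' = ∫ x in Ioi 0, |h' x| * (1 + x) := ⟨_, rfl⟩
  have hN'0 : 0 ≤ N' := by
    rw [hN'def]
    exact setIntegral_nonneg measurableSet_Ioi fun x hx ↦
      mul_nonneg (abs_nonneg _) (by have : (0 : ℝ) < x := hx; linarith)
  -- the window `X` and the constants
  obtain ⟨X, hXdef⟩ : ∃ X : ℝ, X = μ + D + 6 := ⟨_, rfl⟩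
  have hX7 : 7 ≤ X := by rw [hXdef]; linarith
  have hX0 : 0 ≤ X := by linarith
  have hgap : μ + D + 6 ≤ 4 * π ^ 2 * X ^ 2 := by
    have hπ : 9 ≤ π ^ 2 := by nlinarith [Real.pi_gt_three]
    have h1 : X ≤ X ^ 2 := by rw [sq]; exact le_mul_of_one_le_left hX0 (by linarith)
    have h2 : X ^ 2 ≤ 4 * π ^ 2 * X ^ 2 := le_mul_of_one_le_left (sq_nonneg X) (by linarith)
    have h3 : μ + D + 6 ≤ X := by rw [hXdef]
    linarith
  obtain ⟨E, hEdef⟩ : ∃ E : ℝ, E = Real.exp (8 * (4 * π ^ 2 * X ^ 2 + μ + 2) * X) := ⟨_, rfl⟩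
  have hE0 : 0 < E := by rw [hEdef]; exact Real.exp_pos _
  obtain ⟨Cx, hCxdef⟩ : ∃ Cx : ℝ, Cx = 2 * X + 4 * π ^ 2 * X ^ 4 + μ * X ^ 2 := ⟨_, rfl⟩
  have hCx0 : 0 ≤ Cx := by rw [hCxdef]; positivity
  obtain ⟨cM, hcMdef⟩ : ∃ cM : ℝ, cM = (h 0 + 1) / h 0 := ⟨_, rfl⟩
  have hcM0 : 0 ≤ cM := by rw [hcMdef]; positivity
  obtain ⟨A₁, hA₁def⟩ : ∃ A₁ : ℝ, A₁ = (h 0 + 1) * (2 * E * (D + Cx)) := ⟨_, rfl⟩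
  have hA₁0 : 0 ≤ A₁ := by rw [hA₁def]; positivity
  obtain ⟨R, hRdef⟩ : ∃ R : ℝ, R = cM * (D * H₁ + Q₁) := ⟨_, rfl⟩
  have hR0 : 0 ≤ R := by rw [hRdef]; positivity
  obtain ⟨m, hmdef⟩ : ∃ m : ℝ, m = R + A₁ * Real.exp (2 * X) := ⟨_, rfl⟩
  have hm0 : 0 ≤ m := by rw [hmdef]; positivity
  have hRm : R ≤ m := by
    rw [hmdef]; have := mul_nonneg hA₁0 (Real.exp_pos (2 * X)).le; linarith
  obtain ⟨A, hAdef⟩ : ∃ A : ℝ, A = 8 * π ^ 2 * m + R := ⟨_, rfl⟩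
  have hA0 : 0 ≤ A := by rw [hAdef]; positivity
  obtain ⟨c₁, hc₁def⟩ : ∃ c₁ : ℝ, c₁ = CS / h 0 := ⟨_, rfl⟩
  obtain ⟨K, hKdef⟩ : ∃ K : ℝ, K = (m + cM * H₁) + (X * A₁ + m + c₁ * H₁)
      + (X * ((1 + X) * A₁) + 56 * A + c₁ * N') := ⟨_, rfl⟩
  refine ⟨K, max (max ΛS ΛD) (max (2 * X + 2) (CS + 1)), fun lam hlam f hf ↦ ?_⟩
  obtain ⟨h12, h34⟩ := max_le_iff.1 hlam
  obtain ⟨hlS, hlD⟩ := max_le_iff.1 h12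
  obtain ⟨hl2X, hlCS⟩ := max_le_iff.1 h34
  have hlam0 := hf.lam_pos
  have hlam1 : 1 ≤ lam := by linarith
  have hlam2 : 2 ≤ lam := by linarith
  have hXl : X < lam := by linarith
  have hXl2 : X ≤ lam / 2 := by linarith
  have hlsq : lam ≤ lam ^ 2 := le_self_pow₀ hlam1 two_ne_zero
  have hl2 : 0 < lam ^ 2 := by positivity
  have hDl : D ≤ lam ^ 2 := by linarith
  obtain ⟨χ, hχ⟩ := hf.eigen
  have hDχ : |χ - lam ^ 2 * μ| ≤ D := hD lam hlD f χ hf hχ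
  have hχlo : lam ^ 2 * μ - D ≤ χ := by have := (abs_le.1 hDχ).1; linarith
  have hχ0 : 0 ≤ χ := by
    have : lam ^ 2 * 1 ≤ lam ^ 2 * μ := mul_le_mul_of_nonneg_left hμ hl2.le
    linarith
  have hχδ : |χ - μ * lam ^ 2| ≤ D / lam ^ 2 * lam ^ 2 := by
    rw [div_mul_cancel₀ _ hl2.ne', mul_comm μ]; exact hDχ
  have hδ0 : 0 ≤ D / lam ^ 2 := div_nonneg hD0 hl2.le
  have hδ1 : D / lam ^ 2 ≤ 1 := by rw [div_le_one hl2]; exact hDl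
  have hdivmono : ∀ {a b : ℝ}, a ≤ b → a / lam ^ 2 ≤ b / lam ^ 2 := fun hab ↦
    div_le_div_of_nonneg_right hab hl2.le
  -- the turning point is below `X`: `(2πλx)² − χ ≥ 6λ²` on `(X, λ)`
  have hturn : 6 * lam ^ 2 ≤ (2 * π * lam * X) ^ 2 - χ := by
    have e : (2 * π * lam * X) ^ 2 = (4 * π ^ 2 * X ^ 2) * lam ^ 2 := by ring
    have h1 : (μ + D + 6) * lam ^ 2 ≤ (4 * π ^ 2 * X ^ 2) * lam ^ 2 :=
      mul_le_mul_of_nonneg_right hgap hl2.le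
    have h2 : D ≤ D * lam ^ 2 := le_mul_of_one_le_right hD0 (by linarith)
    have h3 : χ ≤ lam ^ 2 * μ + D := by have := (abs_le.1 hDχ).2; linarith
    rw [e]; linarith
  have hV6 : ∀ x ∈ Ioo X lam, 6 * lam ^ 2 ≤ (2 * π * lam * x) ^ 2 - χ := by
    intro x hx
    have h1 : (2 * π * lam * X) ^ 2 ≤ (2 * π * lam * x) ^ 2 := by
      have := mul_le_mul_of_nonneg_left hx.1.le (by positivity : (0 : ℝ) ≤ 2 * π * lam)
      exact pow_le_pow_left₀ (by positivity) this 2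
    linarith
  -- the scale `c = f(0)/h(0)`: `|c − 1| ≤ c₁λ^{-2}` from the sup-norm rate at `0`
  have hf0 := hf.pos_zero
  have hS0 : |f 0 - h 0| ≤ CS / lam ^ 2 := hCS lam hlS f hf 0 ⟨by linarith, by linarith⟩
  have hCS0 : 0 ≤ CS := by
    by_contra hneg
    rw [not_le] at hneg
    have : CS / lam ^ 2 < 0 := div_neg_of_neg_of_pos hneg hl2
    linarith [abs_nonneg (f 0 - h 0)]
  have hc₁0 : 0 ≤ c₁ := by rw [hc₁def]; exact div_nonneg hCS0 hh0.le
  obtain ⟨c, hcdef⟩ : ∃ c : ℝ, c = f 0 / h 0 := ⟨_, rfl⟩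
  have hc0 : 0 < c := by rw [hcdef]; exact div_pos hf0 hh0
  have hf01 : f 0 ≤ h 0 + 1 := by
    have h1 := (abs_le.1 hS0).2
    have h2 : CS / lam ^ 2 ≤ 1 := by rw [div_le_one hl2]; linarith
    linarith
  have hccM : c ≤ cM := by rw [hcdef, hcMdef]; exact div_le_div_of_nonneg_right hf01 hh0.le
  have hc1 : |c - 1| ≤ c₁ / lam ^ 2 := by
    have e1 : c - 1 = (f 0 - h 0) / h 0 := by rw [hcdef, div_sub_one hh0.ne']
    rw [e1, abs_div, abs_of_pos hh0, hc₁def, div_right_comm]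
    exact div_le_div_of_nonneg_right hS0 hh0.le
  -- the window `[0, X]`
  have hwin : ∀ x ∈ Icc 0 X, |f x - c * h x| ≤ A₁ / lam ^ 2 ∧
      |deriv f x - c * h' x| ≤ A₁ / lam ^ 2 := by
    intro x hx
    have hw := hf.window_compare hχ hX0 (by linarith : (0 : ℝ) ≤ μ) hδ0 hδ1 hl2X hχ0 hχδ hh hh'
      hh0 hh'0 hx
    rw [← hEdef, ← hCxdef, ← hcdef, ← add_div, ← mul_div_assoc, ← mul_div_assoc] at hw
    have hle : f 0 * (2 * E * (D + Cx)) / lam ^ 2 ≤ A₁ / lam ^ 2 := by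
      rw [hA₁def]
      exact hdivmono (mul_le_mul_of_nonneg_right hf01 (by positivity))
    exact ⟨hw.1.trans hle, hw.2.trans hle⟩
  -- the source term `ρ = c((λ²μ − χ)h + (x²h′)′)` decays like `e^{−2x}`
  have hρ : ∀ x, |c * ((lam ^ 2 * μ - χ) * h x
      + (2 * x * h' x + x ^ 2 * ((4 * π ^ 2 * x ^ 2 - μ) * h x)))| ≤ R * Real.exp (-(2 * x)) := by
    intro x
    rw [abs_mul, abs_of_pos hc0]
    have h1 : |(lam ^ 2 * μ - χ) * h x| ≤ D * (H₁ * Real.exp (-(2 * x))) := by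
      rw [abs_mul]
      have : |lam ^ 2 * μ - χ| ≤ D := by rw [abs_sub_comm]; exact hDχ
      exact mul_le_mul this (hH x) (abs_nonneg _) hD0
    have h3 := (abs_add_le _ _).trans (add_le_add h1 (hQ x))
    rw [hRdef]
    calc c * |(lam ^ 2 * μ - χ) * h x + (2 * x * h' x + x ^ 2 * ((4 * π ^ 2 * x ^ 2 - μ) * h x))|
        ≤ cM * ((D * H₁ + Q₁) * Real.exp (-(2 * x))) :=
          mul_le_mul hccM (by linarith [h3]) (abs_nonneg _) hcM0
      _ = cM * (D * H₁ + Q₁) * Real.exp (-(2 * x)) := by ring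
  -- the left end of the forbidden region: `|e(X)| ≤ A₁λ^{-2} ≤ β(X)`
  have hea : |f X - c * h X| ≤ m / lam ^ 2 * Real.exp (-(2 * X)) := by
    have h1 := (hwin X ⟨hX0, le_rfl⟩).1
    have h2 : A₁ ≤ m * Real.exp (-(2 * X)) := by
      have e1 : m * Real.exp (-(2 * X)) = R * Real.exp (-(2 * X)) + A₁ := by
        rw [hmdef, add_mul, mul_assoc, ← Real.exp_add, show 2 * X + -(2 * X) = 0 by ring,
          Real.exp_zero, mul_one]
      rw [e1]
      have := mul_nonneg hR0 (Real.exp_pos (-(2 * X))).le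
      linarith
    calc |f X - c * h X| ≤ A₁ / lam ^ 2 := h1
      _ ≤ m * Real.exp (-(2 * X)) / lam ^ 2 := hdivmono h2
      _ = m / lam ^ 2 * Real.exp (-(2 * X)) := by ring
  -- the forbidden region and the integrals
  obtain ⟨hE, he'1, he'2⟩ := forbidden_region_barrier hf hlam1 hχ hχ0 hh hh' hc0 hX0 hXl hV6 hR0
    hRm hAdef hρ hea
  obtain ⟨Ie, Ie'⟩ := forbidden_region_integrals hf hhc hh'c hlam1 hX0 hXl2 hA0 hwin hE he'1 he'2
  have hexp2l : lam * Real.exp (-(2 * lam)) ≤ 1 / lam ^ 2 := by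
    have h3 := (cube_mul_exp_neg_le (by linarith : 0 ≤ 2 * lam)).1
    rw [le_div_iff₀ hl2]
    linarith
  have hcf : ContinuousOn f (Icc 0 lam) :=
    hf.contDiffOn.continuousOn.mono (Icc_subset_Icc (by linarith) le_rfl)
  have hu : uIcc 0 lam = Icc 0 lam := uIcc_of_le hlam0.le
  have hK0a : 0 ≤ m + cM * H₁ := by positivity
  have hK0b : 0 ≤ X * A₁ + m + c₁ * H₁ := by positivity
  have hK0c : 0 ≤ X * ((1 + X) * A₁) + 56 * A + c₁ * N' := by positivity
  refine ⟨?_, ?_, ?_⟩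
  · -- end-point decay: `|f(λ)| ≤ |e(λ)| + c|h(λ)| ≤ (mλ^{-2} + c_M H₁)e^{−2λ}`
    have h1 := hE lam ⟨hXl.le, le_rfl⟩
    have h2 : |f lam| ≤ (m / lam ^ 2 + cM * H₁) * Real.exp (-(2 * lam)) := by
      calc |f lam| = |(f lam - c * h lam) + c * h lam| := by ring_nf
        _ ≤ |f lam - c * h lam| + |c * h lam| := abs_add_le _ _
        _ ≤ m / lam ^ 2 * Real.exp (-(2 * lam)) + cM * (H₁ * Real.exp (-(2 * lam))) := by
            rw [abs_mul, abs_of_pos hc0]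
            exact add_le_add h1 (mul_le_mul hccM (hH lam) (abs_nonneg _) hcM0)
        _ = (m / lam ^ 2 + cM * H₁) * Real.exp (-(2 * lam)) := by ring
    have h3 : m / lam ^ 2 ≤ m := div_le_self hm0 (hlam1.trans hlsq)
    have hK1 : m + cM * H₁ ≤ K := by rw [hKdef]; linarith only [hK0b, hK0c]
    calc lam * |f lam| ≤ lam * ((m / lam ^ 2 + cM * H₁) * Real.exp (-(2 * lam))) :=
          mul_le_mul_of_nonneg_left h2 hlam0.le
      _ = (m / lam ^ 2 + cM * H₁) * (lam * Real.exp (-(2 * lam))) := by ring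
      _ ≤ (m + cM * H₁) * (1 / lam ^ 2) :=
          mul_le_mul (add_le_add h3 le_rfl) hexp2l (mul_nonneg hlam0.le (Real.exp_pos _).le) hK0a
      _ = (m + cM * H₁) / lam ^ 2 := by ring
      _ ≤ K / lam ^ 2 := hdivmono hK1
  · -- `∫_0^λ |f − h| ≤ ∫_0^λ |e| + |c − 1|∫_0^λ |h|`
    have ie0 : IntervalIntegrable (fun x ↦ |f x - c * h x|) volume 0 lam :=
      (((hcf.sub (continuousOn_const.mul hhc.continuousOn)).abs).mono hu.le).intervalIntegrable
    have iha : IntervalIntegrable (fun x ↦ c₁ / lam ^ 2 * (H₁ * Real.exp (-(2 * x)))) volume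
        0 lam :=
      (by fun_prop : Continuous fun x ↦ c₁ / lam ^ 2 * (H₁ * Real.exp (-(2 * x)))).intervalIntegrable
        _ _
    have ifh : IntervalIntegrable (fun x ↦ |f x - h x|) volume 0 lam :=
      (((hcf.sub hhc.continuousOn).abs).mono hu.le).intervalIntegrable
    have hpt : ∀ x ∈ Icc 0 lam,
        |f x - h x| ≤ |f x - c * h x| + c₁ / lam ^ 2 * (H₁ * Real.exp (-(2 * x))) := by
      intro x _
      have e1 : f x - h x = (f x - c * h x) + (c - 1) * h x := by ring
      rw [e1]
      calc |(f x - c * h x) + (c - 1) * h x| ≤ |f x - c * h x| + |(c - 1) * h x| :=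
            abs_add_le _ _
        _ ≤ |f x - c * h x| + c₁ / lam ^ 2 * (H₁ * Real.exp (-(2 * x))) := by
            rw [abs_mul]
            exact add_le_add le_rfl (mul_le_mul hc1 (hH x) (abs_nonneg _) (by positivity))
    have h1 := intervalIntegral.integral_mono_on hlam0.le ifh (ie0.add iha) hpt
    rw [intervalIntegral.integral_add ie0 iha, intervalIntegral.integral_const_mul,
      intervalIntegral.integral_const_mul, integral_exp_neg_two_mul] at h1
    have h2 : (Real.exp (-(2 * 0)) - Real.exp (-(2 * lam))) / 2 ≤ 1 := by
      have := Real.exp_pos (-(2 * lam))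
      simp only [mul_zero, neg_zero, Real.exp_zero]
      linarith
    have h3 : c₁ / lam ^ 2 * (H₁ * ((Real.exp (-(2 * 0)) - Real.exp (-(2 * lam))) / 2))
        ≤ c₁ / lam ^ 2 * (H₁ * 1) :=
      mul_le_mul_of_nonneg_left (mul_le_mul_of_nonneg_left h2 hH0) (by positivity)
    have hK2 : X * A₁ + m + c₁ * H₁ ≤ K := by rw [hKdef]; linarith only [hK0a, hK0c]
    calc (∫ x in (0 : ℝ)..lam, |f x - h x|)
        ≤ (X * A₁ + m) / lam ^ 2 + c₁ / lam ^ 2 * (H₁ * 1) := by linarith only [h1, Ie, h3]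
      _ = (X * A₁ + m + c₁ * H₁) / lam ^ 2 := by ring
      _ ≤ K / lam ^ 2 := hdivmono hK2
  · -- `∫_0^λ |f′ − h′|(1+x) ≤ ∫_0^λ |e′|(1+x) + |c − 1|∫_0^∞ |h′|(1+x)`
    have ie' : IntervalIntegrable (fun x ↦ |deriv f x - c * h' x| * (1 + x)) volume 0 lam :=
      ((hf.intervalIntegrable_deriv.sub ((hh'c.intervalIntegrable _ _).const_mul c)).abs).mul_continuousOn
        (by fun_prop)
    have ik : IntervalIntegrable (fun x ↦ |h' x| * (1 + x)) volume 0 lam :=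
      (hh'c.abs.mul (continuous_const.add continuous_id)).intervalIntegrable _ _
    have ifh : IntervalIntegrable (fun x ↦ |deriv f x - h' x| * (1 + x)) volume 0 lam :=
      ((hf.intervalIntegrable_deriv.sub (hh'c.intervalIntegrable _ _)).abs).mul_continuousOn
        (by fun_prop)
    have hpt : ∀ x ∈ Icc 0 lam, |deriv f x - h' x| * (1 + x)
        ≤ |deriv f x - c * h' x| * (1 + x) + c₁ / lam ^ 2 * (|h' x| * (1 + x)) := by
      intro x hx
      have hx1 : 0 ≤ 1 + x := by linarith [hx.1]
      have e1 : deriv f x - h' x = (deriv f x - c * h' x) + (c - 1) * h' x := by ring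
      rw [e1]
      have t : |(deriv f x - c * h' x) + (c - 1) * h' x|
          ≤ |deriv f x - c * h' x| + c₁ / lam ^ 2 * |h' x| := by
        calc _ ≤ |deriv f x - c * h' x| + |(c - 1) * h' x| := abs_add_le _ _
          _ ≤ _ := by
              rw [abs_mul]
              exact add_le_add le_rfl (mul_le_mul_of_nonneg_right hc1 (abs_nonneg _))
      have := mul_le_mul_of_nonneg_right t hx1
      linarith [this]
    have h1 := intervalIntegral.integral_mono_on hlam0.le ifh (ie'.add (ik.const_mul _)) hpt
    rw [intervalIntegral.integral_add ie' (ik.const_mul _), intervalIntegral.integral_const_mul] at h1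
    have hk : (∫ x in (0 : ℝ)..lam, |h' x| * (1 + x)) ≤ N' := by
      rw [hN'def, intervalIntegral.integral_of_le hlam0.le]
      exact setIntegral_mono_set Ih'
        ((ae_restrict_mem measurableSet_Ioi).mono fun x hx ↦
          mul_nonneg (abs_nonneg _) (by have : (0 : ℝ) < x := hx; linarith))
        Ioc_subset_Ioi_self.eventuallyLE
    have h3 : c₁ / lam ^ 2 * (∫ x in (0 : ℝ)..lam, |h' x| * (1 + x)) ≤ c₁ / lam ^ 2 * N' :=
      mul_le_mul_of_nonneg_left hk (by positivity)
    have hK3 : X * ((1 + X) * A₁) + 56 * A + c₁ * N' ≤ K := by rw [hKdef]; linarith only [hK0a, hK0b]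
    calc (∫ x in (0 : ℝ)..lam, |deriv f x - h' x| * (1 + x))
        ≤ (X * ((1 + X) * A₁) + 56 * A) / lam ^ 2 + c₁ / lam ^ 2 * N' := by
          linarith only [h1, Ie', h3]
      _ = (X * ((1 + X) * A₁) + 56 * A + c₁ * N') / lam ^ 2 := by ring
      _ ≤ K / lam ^ 2 := hdivmono hK3

/-- The rate package for `n = 0`: `λ|h_{0,λ}(λ)|`, `∫_0^λ|h_{0,λ} − h_0|` and
`∫_0^λ|h_{0,λ}′ − h_0′|(1+x)` are all `O(λ^{-2})`, uniformly over the prolate functions.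
[cite: ConnesConsaniMoscovici2025, Lemma 7.2, eq. (7.8)] -/
theorem w11Rate_zero : ∃ K Λ : ℝ, ∀ lam : ℝ, Λ ≤ lam → ∀ f : ℝ → ℝ,
    IsProlateFunction lam 0 f →
      lam * |f lam| ≤ K / lam ^ 2 ∧ (∫ x in (0 : ℝ)..lam, |f x - hermiteH0 x|) ≤ K / lam ^ 2 ∧
        (∫ x in (0 : ℝ)..lam, |deriv f x - hermiteH0' x| * (1 + x)) ≤ K / lam ^ 2 :=
  w11Rate_of_supNormRate (μ := 2 * π) (by linarith [Real.pi_gt_three]) hasDerivAt_hermiteH0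
    hasDerivAt_hermiteH0' (hermiteH0_pos 0) hermiteH0'_zero (fun x ↦ abs_hermiteH0_le_exp x)
    (fun x ↦ abs_q_hermiteH0_le_exp x) integrableOn_abs_hermiteH0'_mul prolateSupNormRate_zero
    IsProlateFunction.eigen_sub_le_of_zero

/-- The rate package for `n = 4`: `λ|h_{4,λ}(λ)|`, `∫_0^λ|h_{4,λ} − h_4|` and
`∫_0^λ|h_{4,λ}′ − h_4′|(1+x)` are all `O(λ^{-2})`, uniformly over the prolate functions.
[cite: ConnesConsaniMoscovici2025, Lemma 7.2, eq. (7.8)] -/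
theorem w11Rate_four : ∃ K Λ : ℝ, ∀ lam : ℝ, Λ ≤ lam → ∀ f : ℝ → ℝ,
    IsProlateFunction lam 4 f →
      lam * |f lam| ≤ K / lam ^ 2 ∧ (∫ x in (0 : ℝ)..lam, |f x - hermiteH4 x|) ≤ K / lam ^ 2 ∧
        (∫ x in (0 : ℝ)..lam, |deriv f x - hermiteH4' x| * (1 + x)) ≤ K / lam ^ 2 :=
  w11Rate_of_supNormRate (μ := 18 * π) (by linarith [Real.pi_gt_three]) hasDerivAt_hermiteH4
    hasDerivAt_hermiteH4' hermiteH4_zero_pos hermiteH4'_zero (fun x ↦ abs_hermiteH4_le_exp x)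
    (fun x ↦ abs_q_hermiteH4_le_exp x) integrableOn_abs_hermiteH4'_mul prolateSupNormRate_four
    IsProlateFunction.eigen_sub_le_of_four

/-! ### Part C: the rate in Connes' Fact 6.4 / CCM25 Lemma 7.3 -/

/-- Exponential tail of an interval integral: if `|h| ≤ H₁e^{−2x}` then
`|∫_0^λ h − ∫_0^∞ h| ≤ H₁e^{−2λ}/2`. [folklore] -/
theorem abs_intervalIntegral_sub_integral_Ioi_le {h : ℝ → ℝ} (hc : Continuous h)
    (hi : Integrable h) {H₁ : ℝ} (hH : ∀ x, |h x| ≤ H₁ * Real.exp (-(2 * x))) (lam : ℝ) :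
    |(∫ x in (0 : ℝ)..lam, h x) - ∫ x in Ioi (0 : ℝ), h x| ≤ H₁ * Real.exp (-(2 * lam)) / 2 := by
  have hT := intervalIntegral_tendsto_integral_Ioi 0 hi.integrableOn tendsto_id
  have hg : Tendsto (fun b : ℝ ↦ |(∫ x in (0 : ℝ)..lam, h x) - ∫ x in (0 : ℝ)..b, h x|) atTop
      (𝓝 |(∫ x in (0 : ℝ)..lam, h x) - ∫ x in Ioi (0 : ℝ), h x|) :=
    (tendsto_const_nhds.sub hT).abs
  refine le_of_tendsto hg (eventually_atTop.2 ⟨lam, fun b hb ↦ ?_⟩)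
  have hi' : ∀ a b : ℝ, IntervalIntegrable h volume a b := fun a b ↦ hc.intervalIntegrable _ _
  have hH0 : 0 ≤ H₁ := by
    have := (abs_nonneg _).trans (hH 0)
    simpa using this
  have hsplit : (∫ x in (0 : ℝ)..b, h x) = (∫ x in (0 : ℝ)..lam, h x) + ∫ x in lam..b, h x :=
    (intervalIntegral.integral_add_adjacent_intervals (hi' 0 lam) (hi' lam b)).symm
  rw [hsplit, show (∫ x in (0 : ℝ)..lam, h x) - ((∫ x in (0 : ℝ)..lam, h x) + ∫ x in lam..b, h x)
      = -∫ x in lam..b, h x by ring, abs_neg]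
  have hci : IntervalIntegrable (fun x ↦ H₁ * Real.exp (-(2 * x))) volume lam b :=
    (by fun_prop : Continuous fun x ↦ H₁ * Real.exp (-(2 * x))).intervalIntegrable _ _
  calc |∫ x in lam..b, h x| ≤ ∫ x in lam..b, |h x| :=
        intervalIntegral.abs_integral_le_integral_abs hb
    _ ≤ ∫ x in lam..b, H₁ * Real.exp (-(2 * x)) :=
        intervalIntegral.integral_mono_on hb (hi' lam b).abs hci (fun x _ ↦ hH x)
    _ = H₁ * ((Real.exp (-(2 * lam)) - Real.exp (-(2 * b))) / 2) := by
        rw [intervalIntegral.integral_const_mul, integral_exp_neg_two_mul]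
    _ ≤ H₁ * (Real.exp (-(2 * lam)) / 2) := by
        refine mul_le_mul_of_nonneg_left ?_ hH0
        have := Real.exp_pos (-(2 * b))
        linarith
    _ = H₁ * Real.exp (-(2 * lam)) / 2 := by ring

set_option maxHeartbeats 800000 in
/-- **Rate for `ρ_λ → ρ`**: from the `L¹` rates `∫_0^λ |h_{n,λ} − h_n| = O(λ^{-2})` (`n = 0, 4`),
`|ρ_λ − ρ| ≤ K/λ²` for `λ ≥ Λ`, uniformly over the prolate functions.
[cite: ConnesConsaniMoscovici2025, Lemma 7.2] -/
theorem prolateGuessRatio_rate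
    (hI0 : ∃ K Λ : ℝ, ∀ lam : ℝ, Λ ≤ lam → ∀ f : ℝ → ℝ, IsProlateFunction lam 0 f →
      (∫ x in (0 : ℝ)..lam, |f x - hermiteH0 x|) ≤ K / lam ^ 2)
    (hI4 : ∃ K Λ : ℝ, ∀ lam : ℝ, Λ ≤ lam → ∀ f : ℝ → ℝ, IsProlateFunction lam 4 f →
      (∫ x in (0 : ℝ)..lam, |f x - hermiteH4 x|) ≤ K / lam ^ 2) :
    ∃ K Λ : ℝ, 0 ≤ K ∧ ∀ lam : ℝ, Λ ≤ lam → ∀ f0 f4 : ℝ → ℝ, IsProlateFunction lam 0 f0 →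
      IsProlateFunction lam 4 f4 → |prolateGuessRatio lam f0 f4 - hermiteRho| ≤ K / lam ^ 2 := by
  obtain ⟨K0, Λ0, hK0⟩ := hI0
  obtain ⟨K4, Λ4, hK4⟩ := hI4
  have hA := prolateGuessA_pos
  set J0 := ∫ x in Ioi (0 : ℝ), hermiteH0 x with hJ0def
  have hJ0 : 0 < J0 := integral_hermiteH0_Ioi_pos
  have hJ4 : ∫ x in Ioi (0 : ℝ), hermiteH4 x = hermiteRho * J0 := integral_hermiteH4_Ioi
  set ρ := hermiteRho with hρdef
  have hρ1 : 0 < 1 + |ρ| := by positivity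
  -- Hermite tail constants and the master constant
  set H0c : ℝ := (2 : ℝ) ^ ((1 : ℝ) / 4) * Real.exp 1 with hH0cdef
  set H4c : ℝ := 179 * Real.exp 1 / (16 * prolateGuessA) with hH4cdef
  have hH0c : 0 ≤ H0c := by positivity
  have hH4c : 0 ≤ H4c := by positivity
  set K' : ℝ := |K0| + |K4| + H0c + H4c with hK'def
  have hK'0 : 0 ≤ K' := by positivity
  refine ⟨4 * K' * (1 + |ρ|) / J0, max (max Λ0 Λ4) (max 1 (4 * K' / J0)), by positivity,
    fun lam hlam f0 f4 h0 h4 ↦ ?_⟩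
  obtain ⟨h12, h34⟩ := max_le_iff.1 hlam
  obtain ⟨hl0, hl4⟩ := max_le_iff.1 h12
  obtain ⟨hl1, hlK⟩ := max_le_iff.1 h34
  have hlam0 : 0 < lam := by linarith
  have hl2 : 0 < lam ^ 2 := by positivity
  set e : ℝ := K' / lam ^ 2 with he_def
  have he0 : 0 ≤ e := by positivity
  have hdivmono : ∀ {a b : ℝ}, a ≤ b → a / lam ^ 2 ≤ b / lam ^ 2 :=
    fun hab ↦ div_le_div_of_nonneg_right hab hl2.le
  -- `4e ≤ J0`
  have h4e : 4 * e ≤ J0 := by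
    have h1 : K' / lam ^ 2 ≤ K' / lam :=
      div_le_div_of_nonneg_left hK'0 hlam0 (by nlinarith only [hl1])
    have h2 : 4 * K' ≤ lam * J0 := by
      have := (div_le_iff₀ hJ0).1 hlK
      linarith
    have h3 : 4 * (K' / lam) ≤ J0 := by
      rw [mul_div_assoc', div_le_iff₀ hlam0]
      linarith
    linarith
  -- exponential tail `e^{−2λ}/2 ≤ 1/λ²`
  have hexp : Real.exp (-(2 * lam)) / 2 ≤ 1 / lam ^ 2 := by
    have h := (mul_exp_neg_le (by linarith : (0 : ℝ) ≤ 2 * lam)).2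
    rw [div_le_div_iff₀ two_pos hl2]
    nlinarith [Real.exp_pos (-(2 * lam))]
  -- the four estimates, each `≤ e`
  have s0 : (∫ x in (0 : ℝ)..lam, |f0 x - hermiteH0 x|) ≤ e :=
    (hK0 lam hl0 f0 h0).trans (hdivmono ((le_abs_self K0).trans
      (by linarith [abs_nonneg K0, abs_nonneg K4])))
  have s4 : (∫ x in (0 : ℝ)..lam, |f4 x - hermiteH4 x|) ≤ e :=
    (hK4 lam hl4 f4 h4).trans (hdivmono ((le_abs_self K4).trans
      (by linarith [abs_nonneg K0, abs_nonneg K4])))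
  have t0 : |(∫ x in (0 : ℝ)..lam, hermiteH0 x) - J0| ≤ e := by
    have h := abs_intervalIntegral_sub_integral_Ioi_le continuous_hermiteH0 integrable_hermiteH0
      (fun x ↦ abs_hermiteH0_le_exp x) lam
    calc _ ≤ H0c * Real.exp (-(2 * lam)) / 2 := h
      _ = H0c * (Real.exp (-(2 * lam)) / 2) := by ring
      _ ≤ H0c * (1 / lam ^ 2) := mul_le_mul_of_nonneg_left hexp hH0c
      _ = H0c / lam ^ 2 := by ring
      _ ≤ e := hdivmono (by linarith [abs_nonneg K0, abs_nonneg K4])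
  have t4 : |(∫ x in (0 : ℝ)..lam, hermiteH4 x) - ρ * J0| ≤ e := by
    have h := abs_intervalIntegral_sub_integral_Ioi_le continuous_hermiteH4 integrable_hermiteH4
      (fun x ↦ abs_hermiteH4_le_exp x) lam
    rw [hJ4] at h
    calc _ ≤ H4c * Real.exp (-(2 * lam)) / 2 := h
      _ = H4c * (Real.exp (-(2 * lam)) / 2) := by ring
      _ ≤ H4c * (1 / lam ^ 2) := mul_le_mul_of_nonneg_left hexp hH4c
      _ = H4c / lam ^ 2 := by ring
      _ ≤ e := hdivmono (by linarith [abs_nonneg K0, abs_nonneg K4])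
  have a0 := abs_integral_sub_two_mul_integral_le_of_L1 h0 continuous_hermiteH0 s0
  have a4 := abs_integral_sub_two_mul_integral_le_of_L1 h4 continuous_hermiteH4 s4
  unfold prolateGuessRatio
  set I0 := ∫ x in (-lam)..lam, f0 x with hI0
  set I4 := ∫ x in (-lam)..lam, f4 x with hI4
  set T0' := ∫ x in (0 : ℝ)..lam, hermiteH0 x with hT0'
  set T4' := ∫ x in (0 : ℝ)..lam, hermiteH4 x with hT4'
  have b0 : |I0 - 2 * J0| ≤ 4 * e := by
    calc |I0 - 2 * J0| = |(I0 - 2 * T0') + 2 * (T0' - J0)| := by ring_nf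
      _ ≤ |I0 - 2 * T0'| + |2 * (T0' - J0)| := abs_add_le _ _
      _ ≤ 2 * e + 2 * e := by rw [abs_mul, abs_two]; linarith
      _ = 4 * e := by ring
  have b4 : |I4 - 2 * (ρ * J0)| ≤ 4 * e := by
    calc |I4 - 2 * (ρ * J0)| = |(I4 - 2 * T4') + 2 * (T4' - ρ * J0)| := by ring_nf
      _ ≤ |I4 - 2 * T4'| + |2 * (T4' - ρ * J0)| := abs_add_le _ _
      _ ≤ 2 * e + 2 * e := by rw [abs_mul, abs_two]; linarith
      _ = 4 * e := by ring
  have hI0pos : J0 ≤ I0 := by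
    have := (abs_sub_le_iff.1 b0).2
    linarith
  have hI0ne : I0 ≠ 0 := by linarith
  have hnum : |I4 - ρ * I0| ≤ 4 * e * (1 + |ρ|) := by
    calc |I4 - ρ * I0| = |(I4 - 2 * (ρ * J0)) - ρ * (I0 - 2 * J0)| := by ring_nf
      _ ≤ |I4 - 2 * (ρ * J0)| + |ρ * (I0 - 2 * J0)| := abs_sub _ _
      _ ≤ 4 * e + |ρ| * (4 * e) := by
          rw [abs_mul]
          exact add_le_add b4 (mul_le_mul_of_nonneg_left b0 (abs_nonneg _))
      _ = 4 * e * (1 + |ρ|) := by ring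
  have hq : I4 / I0 - ρ = (I4 - ρ * I0) / I0 := by
    rw [eq_div_iff hI0ne, sub_mul, div_mul_cancel₀ _ hI0ne]
  rw [hq, abs_div, abs_of_pos (by linarith : (0 : ℝ) < I0)]
  calc |I4 - ρ * I0| / I0 ≤ 4 * e * (1 + |ρ|) / J0 := by
        calc |I4 - ρ * I0| / I0 ≤ |I4 - ρ * I0| / J0 :=
              div_le_div_of_nonneg_left (abs_nonneg _) hJ0 hI0pos
          _ ≤ 4 * e * (1 + |ρ|) / J0 := div_le_div_of_nonneg_right hnum hJ0.le
    _ = 4 * K' * (1 + |ρ|) / J0 / lam ^ 2 := by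
        rw [he_def]
        field_simp

set_option maxHeartbeats 800000 in
/-- **Rates for the guess `h_λ`**: from the two rate packages (`n = 0, 4`),
`λ|h_λ(λ)| ≤ K/λ²` and `∫_0^λ |h_λ′ − h′|(1+x)dx ≤ K/λ²` for `λ ≥ Λ`, uniformly over the prolate
functions. [cite: ConnesConsaniMoscovici2025, Lemma 7.2; Connes2026Letter, §6.4] -/
theorem prolateGuessH_rate
    (R0 : ∃ K Λ : ℝ, ∀ lam : ℝ, Λ ≤ lam → ∀ f : ℝ → ℝ, IsProlateFunction lam 0 f →
      lam * |f lam| ≤ K / lam ^ 2 ∧ (∫ x in (0 : ℝ)..lam, |f x - hermiteH0 x|) ≤ K / lam ^ 2 ∧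
        (∫ x in (0 : ℝ)..lam, |deriv f x - hermiteH0' x| * (1 + x)) ≤ K / lam ^ 2)
    (R4 : ∃ K Λ : ℝ, ∀ lam : ℝ, Λ ≤ lam → ∀ f : ℝ → ℝ, IsProlateFunction lam 4 f →
      lam * |f lam| ≤ K / lam ^ 2 ∧ (∫ x in (0 : ℝ)..lam, |f x - hermiteH4 x|) ≤ K / lam ^ 2 ∧
        (∫ x in (0 : ℝ)..lam, |deriv f x - hermiteH4' x| * (1 + x)) ≤ K / lam ^ 2) :
    ∃ K Λ : ℝ, 0 ≤ K ∧ ∀ lam : ℝ, Λ ≤ lam → ∀ f0 f4 : ℝ → ℝ, IsProlateFunction lam 0 f0 →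
      IsProlateFunction lam 4 f4 →
        |prolateGuessH lam f0 f4 lam| * lam ≤ K / lam ^ 2 ∧
        (∫ x in (0 : ℝ)..lam, |deriv (prolateGuessH lam f0 f4) x - connesHermiteH' x| * (1 + x))
          ≤ K / lam ^ 2 := by
  obtain ⟨K0, Λ0, hK0⟩ := R0
  obtain ⟨K4, Λ4, hK4⟩ := R4
  obtain ⟨KR, ΛR, hKR0, hKR⟩ := prolateGuessRatio_rate
    ⟨K0, Λ0, fun lam hl f hf ↦ (hK0 lam hl f hf).2.1⟩ ⟨K4, Λ4, fun lam hl f hf ↦ (hK4 lam hl f hf).2.1⟩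
  have hA := prolateGuessA_pos
  set A := prolateGuessA with hAdef
  set ρ := hermiteRho with hρdef
  set C1 := ∫ x in Ioi (0 : ℝ), |hermiteH0' x| * (1 + x) with hC1def
  have hC1 : 0 ≤ C1 :=
    setIntegral_nonneg measurableSet_Ioi fun x hx ↦ mul_nonneg (abs_nonneg _) (by
      have : (0 : ℝ) < x := hx
      linarith)
  refine ⟨A * (|K4| + (|ρ| + 1) * |K0| + KR * C1), max (max Λ0 Λ4) (max ΛR (KR + 1)),
    by positivity, fun lam hlam f0 f4 h0 h4 ↦ ?_⟩
  obtain ⟨h12, h34⟩ := max_le_iff.1 hlam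
  obtain ⟨hl0, hl4⟩ := max_le_iff.1 h12
  obtain ⟨hlR, hlK⟩ := max_le_iff.1 h34
  have hlam0 : 0 < lam := h0.lam_pos
  have hlam1 : 1 ≤ lam := by linarith
  have hl2 : 0 < lam ^ 2 := by positivity
  have hdivmono : ∀ {a b : ℝ}, a ≤ b → a / lam ^ 2 ≤ b / lam ^ 2 :=
    fun hab ↦ div_le_div_of_nonneg_right hab hl2.le
  obtain ⟨u0, -, w0⟩ := hK0 lam hl0 f0 h0
  obtain ⟨u4, -, w4⟩ := hK4 lam hl4 f4 h4
  have hrρ := hKR lam hlR f0 f4 h0 h4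
  set R := prolateGuessRatio lam f0 f4 with hRdef
  have hKR1 : KR / lam ^ 2 ≤ 1 := by
    rw [div_le_one hl2]
    nlinarith only [hlK, hlam1]
  have hr : |R| ≤ |ρ| + 1 := by
    calc |R| = |(R - ρ) + ρ| := by ring_nf
      _ ≤ |R - ρ| + |ρ| := abs_add_le _ _
      _ ≤ |ρ| + 1 := by linarith
  have u0' : lam * |f0 lam| ≤ |K0| / lam ^ 2 := u0.trans (hdivmono (le_abs_self _))
  have u4' : lam * |f4 lam| ≤ |K4| / lam ^ 2 := u4.trans (hdivmono (le_abs_self _))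
  have w0' : (∫ x in (0 : ℝ)..lam, |deriv f0 x - hermiteH0' x| * (1 + x)) ≤ |K0| / lam ^ 2 :=
    w0.trans (hdivmono (le_abs_self _))
  have w4' : (∫ x in (0 : ℝ)..lam, |deriv f4 x - hermiteH4' x| * (1 + x)) ≤ |K4| / lam ^ 2 :=
    w4.trans (hdivmono (le_abs_self _))
  constructor
  · -- (E): endpoint rate
    rw [prolateGuessH_eq, abs_mul, abs_of_pos hA]
    have step : |f4 lam - R * f0 lam| * lam ≤ |K4| / lam ^ 2 + (|ρ| + 1) * (|K0| / lam ^ 2) := by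
      have h1 : |f4 lam - R * f0 lam| ≤ |f4 lam| + |R| * |f0 lam| := by
        calc _ ≤ |f4 lam| + |R * f0 lam| := abs_sub _ _
          _ = _ := by rw [abs_mul]
      have h2 : |R| * (lam * |f0 lam|) ≤ (|ρ| + 1) * (|K0| / lam ^ 2) :=
        mul_le_mul hr u0' (by positivity) (by positivity)
      have h3 : |f4 lam - R * f0 lam| * lam ≤ (|f4 lam| + |R| * |f0 lam|) * lam :=
        mul_le_mul_of_nonneg_right h1 hlam0.le
      have h4' : (|f4 lam| + |R| * |f0 lam|) * lam = lam * |f4 lam| + |R| * (lam * |f0 lam|) := by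
        ring
      linarith only [h2, h3, h4', u4']
    calc A * |f4 lam - R * f0 lam| * lam = A * (|f4 lam - R * f0 lam| * lam) := by ring
      _ ≤ A * (|K4| / lam ^ 2 + (|ρ| + 1) * (|K0| / lam ^ 2)) := mul_le_mul_of_nonneg_left step hA.le
      _ = A * (|K4| + (|ρ| + 1) * |K0|) / lam ^ 2 := by ring
      _ ≤ A * (|K4| + (|ρ| + 1) * |K0| + KR * C1) / lam ^ 2 := by
          refine hdivmono (mul_le_mul_of_nonneg_left ?_ hA.le)
          have : 0 ≤ KR * C1 := by positivity
          linarith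
  · -- (W): weighted `W^{1,1}` rate
    obtain ⟨-, hdi⟩ := prolateGuessH_hasDerivAt h0 h4
    have iL : IntervalIntegrable
        (fun x ↦ |deriv (prolateGuessH lam f0 f4) x - connesHermiteH' x| * (1 + x)) volume 0 lam :=
      (hdi.sub (continuous_connesHermiteH'.intervalIntegrable _ _)).abs.mul_continuousOn
        (by fun_prop)
    have i4 : IntervalIntegrable (fun x ↦ |deriv f4 x - hermiteH4' x| * (1 + x)) volume 0 lam :=
      (h4.intervalIntegrable_deriv.sub (continuous_hermiteH4'.intervalIntegrable _ _)).abs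
        |>.mul_continuousOn (by fun_prop)
    have i0 : IntervalIntegrable (fun x ↦ |deriv f0 x - hermiteH0' x| * (1 + x)) volume 0 lam :=
      (h0.intervalIntegrable_deriv.sub (continuous_hermiteH0'.intervalIntegrable _ _)).abs
        |>.mul_continuousOn (by fun_prop)
    have ik : IntervalIntegrable (fun x ↦ |hermiteH0' x| * (1 + x)) volume 0 lam :=
      (continuous_hermiteH0'.abs.mul (continuous_const.add continuous_id)).intervalIntegrable _ _
    have hpt : ∀ x ∈ Ioo 0 lam,
        |deriv (prolateGuessH lam f0 f4) x - connesHermiteH' x| * (1 + x)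
          ≤ A * (|deriv f4 x - hermiteH4' x| * (1 + x) + |R| * (|deriv f0 x - hermiteH0' x| * (1 + x))
              + |R - ρ| * (|hermiteH0' x| * (1 + x))) := by
      intro x hx
      have hx' : x ∈ Ioo (-lam) lam := ⟨by linarith [hx.1], hx.2⟩
      have hx1 : 0 ≤ 1 + x := by linarith [hx.1]
      rw [deriv_prolateGuessH h0 h4 hx', ← prolateGuessA_mul_hermite_sub' x]
      have e : A * (deriv f4 x - R * deriv f0 x) - A * (hermiteH4' x - ρ * hermiteH0' x)
          = A * ((deriv f4 x - hermiteH4' x) - R * (deriv f0 x - hermiteH0' x)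
              - (R - ρ) * hermiteH0' x) := by ring
      rw [e, abs_mul, abs_of_pos hA, mul_assoc]
      refine mul_le_mul_of_nonneg_left ?_ hA.le
      have t : |(deriv f4 x - hermiteH4' x) - R * (deriv f0 x - hermiteH0' x) - (R - ρ) * hermiteH0' x|
          ≤ |deriv f4 x - hermiteH4' x| + |R| * |deriv f0 x - hermiteH0' x|
              + |R - ρ| * |hermiteH0' x| := by
        calc _ ≤ |(deriv f4 x - hermiteH4' x) - R * (deriv f0 x - hermiteH0' x)|
              + |(R - ρ) * hermiteH0' x| := abs_sub _ _
          _ ≤ |deriv f4 x - hermiteH4' x| + |R * (deriv f0 x - hermiteH0' x)|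
              + |(R - ρ) * hermiteH0' x| := by gcongr; exact abs_sub _ _
          _ = _ := by rw [abs_mul, abs_mul]
      have := mul_le_mul_of_nonneg_right t hx1
      linarith [this]
    have hint : (∫ x in (0 : ℝ)..lam,
        |deriv (prolateGuessH lam f0 f4) x - connesHermiteH' x| * (1 + x))
          ≤ ∫ x in (0 : ℝ)..lam, A * (|deriv f4 x - hermiteH4' x| * (1 + x)
              + |R| * (|deriv f0 x - hermiteH0' x| * (1 + x)) + |R - ρ| * (|hermiteH0' x| * (1 + x))) :=
      intervalIntegral.integral_mono_on_of_le_Ioo hlam0.le iL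
        (((i4.add (i0.const_mul |R|)).add (ik.const_mul |R - ρ|)).const_mul A) hpt
    have hsplit : (∫ x in (0 : ℝ)..lam, A * (|deriv f4 x - hermiteH4' x| * (1 + x)
        + |R| * (|deriv f0 x - hermiteH0' x| * (1 + x)) + |R - ρ| * (|hermiteH0' x| * (1 + x))))
          = A * ((∫ x in (0 : ℝ)..lam, |deriv f4 x - hermiteH4' x| * (1 + x))
              + |R| * (∫ x in (0 : ℝ)..lam, |deriv f0 x - hermiteH0' x| * (1 + x))
              + |R - ρ| * (∫ x in (0 : ℝ)..lam, |hermiteH0' x| * (1 + x))) := by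
      rw [intervalIntegral.integral_const_mul, intervalIntegral.integral_add (i4.add (i0.const_mul _))
        (ik.const_mul _), intervalIntegral.integral_add i4 (i0.const_mul _),
        intervalIntegral.integral_const_mul, intervalIntegral.integral_const_mul]
    have hk : (∫ x in (0 : ℝ)..lam, |hermiteH0' x| * (1 + x)) ≤ C1 := by
      rw [intervalIntegral.integral_of_le hlam0.le]
      exact setIntegral_mono_set integrableOn_abs_hermiteH0'_mul
        ((ae_restrict_mem measurableSet_Ioi).mono fun x hx ↦
          mul_nonneg (abs_nonneg _) (by have : (0 : ℝ) < x := hx; linarith))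
        Ioc_subset_Ioi_self.eventuallyLE
    have hk0 : 0 ≤ ∫ x in (0 : ℝ)..lam, |deriv f0 x - hermiteH0' x| * (1 + x) :=
      intervalIntegral.integral_nonneg hlam0.le fun x hx ↦
        mul_nonneg (abs_nonneg _) (by linarith [hx.1])
    have hkk0 : 0 ≤ ∫ x in (0 : ℝ)..lam, |hermiteH0' x| * (1 + x) :=
      intervalIntegral.integral_nonneg hlam0.le fun x hx ↦
        mul_nonneg (abs_nonneg _) (by linarith [hx.1])
    have p0 : |R| * (∫ x in (0 : ℝ)..lam, |deriv f0 x - hermiteH0' x| * (1 + x))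
        ≤ (|ρ| + 1) * (|K0| / lam ^ 2) := mul_le_mul hr w0' hk0 (by positivity)
    have pk : |R - ρ| * (∫ x in (0 : ℝ)..lam, |hermiteH0' x| * (1 + x)) ≤ KR / lam ^ 2 * C1 :=
      mul_le_mul hrρ hk hkk0 (by positivity)
    calc _ ≤ _ := hint
      _ = _ := hsplit
      _ ≤ A * (|K4| / lam ^ 2 + (|ρ| + 1) * (|K0| / lam ^ 2) + KR / lam ^ 2 * C1) :=
          mul_le_mul_of_nonneg_left (add_le_add (add_le_add w4' p0) pk) hA.le
      _ = A * (|K4| + (|ρ| + 1) * |K0| + KR * C1) / lam ^ 2 := by ring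

set_option maxHeartbeats 800000 in
/-- **Gaussian tail with a rate**: for `0 < c ≤ 1 ≤ λ`,
`∫_λ^∞ |h′(x)|x^c dx ≤ T₀/(2λ²)` with `T₀ = 3π³/2 + 7π²/2 + 3π/2`
(`|h′(x)|x ≤ T₀e^{−x²} ≤ T₀xe^{−x²}` for `x ≥ 1`, and `λ²e^{−λ²} ≤ 1`). [folklore] -/
theorem integral_Ioi_abs_connesHermiteH'_mul_rpow_le {c : ℝ} (hc : 0 < c) (hc1 : c ≤ 1)
    {lam : ℝ} (hlam1 : 1 ≤ lam) :
    (∫ x in Ioi lam, |connesHermiteH' x| * x ^ c)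
      ≤ (3 * π ^ 3 / 2 + 7 * π ^ 2 / 2 + 3 * π / 2) / (2 * lam ^ 2) := by
  set T₀ : ℝ := 3 * π ^ 3 / 2 + 7 * π ^ 2 / 2 + 3 * π / 2 with hT₀def
  have hπ := Real.pi_gt_three
  have hT₀ : 0 ≤ T₀ := by positivity
  have hlam0 : 0 < lam := by linarith
  have hl2 : 0 < lam ^ 2 := by positivity
  have hF : IntegrableOn (fun x ↦ |connesHermiteH' x| * x ^ c) (Ioi lam) :=
    (integrableOn_abs_connesHermiteH'_mul_rpow hc).mono_set (Ioi_subset_Ioi hlam0.le)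
  have hT := intervalIntegral_tendsto_integral_Ioi lam hF tendsto_id
  refine le_of_tendsto hT (eventually_atTop.2 ⟨lam, fun b hb ↦ ?_⟩)
  -- pointwise majorant on `[λ, b]`
  have hpt : ∀ x ∈ Icc lam b, |connesHermiteH' x| * x ^ c ≤ T₀ * (x * Real.exp (-x ^ 2)) := by
    intro x hx
    have hx1 : 1 ≤ x := hlam1.trans hx.1
    have hx0 : 0 < x := by linarith
    have hxc : x ^ c ≤ x := Real.rpow_le_self_of_one_le hx1 hc1
    have hxc0 : 0 ≤ x ^ c := Real.rpow_nonneg hx0.le _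
    have hee : Real.exp (-π * x ^ 2) = Real.exp (-(π * x ^ 2)) := by ring_nf
    have habs : |connesHermiteH' x|
        ≤ (2 * π ^ 3 * x ^ 5 + 7 * π ^ 2 * x ^ 3 + 3 * π * x) * Real.exp (-(π * x ^ 2)) := by
      unfold connesHermiteH'
      rw [hee, abs_mul, abs_of_pos (Real.exp_pos _)]
      refine mul_le_mul_of_nonneg_right ?_ (Real.exp_pos _).le
      have h5 : 0 ≤ π ^ 3 * x ^ 5 := by positivity
      have h3 : 0 ≤ π ^ 2 * x ^ 3 := by positivity
      have h1 : 0 ≤ π * x := by positivity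
      rw [abs_le]
      constructor <;> linarith only [h5, h3, h1]
    -- `e^{−πx²} ≤ e^{−2x²}·e^{−x²}`
    have hsplit : Real.exp (-(π * x ^ 2)) ≤ Real.exp (-(2 * x ^ 2)) * Real.exp (-x ^ 2) := by
      rw [← Real.exp_add]
      exact Real.exp_le_exp.2 (by nlinarith only [hπ, sq_nonneg x])
    -- polynomial × `e^{−2x²}` is bounded by `T₀` (with `u = 2x²`)
    have hu := mul_exp_neg_le (by positivity : (0 : ℝ) ≤ 2 * x ^ 2)
    have hu3 := (cube_mul_exp_neg_le (by positivity : (0 : ℝ) ≤ 2 * x ^ 2)).1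
    have hpoly : (2 * π ^ 3 * x ^ 5 + 7 * π ^ 2 * x ^ 3 + 3 * π * x) * x * Real.exp (-(2 * x ^ 2))
        ≤ T₀ := by
      have e6 : x ^ 5 * x * Real.exp (-(2 * x ^ 2)) = (2 * x ^ 2) ^ 3 * Real.exp (-(2 * x ^ 2)) / 8 := by
        ring
      have e4 : x ^ 3 * x * Real.exp (-(2 * x ^ 2)) = (2 * x ^ 2) ^ 2 * Real.exp (-(2 * x ^ 2)) / 4 := by
        ring
      have e2 : x * x * Real.exp (-(2 * x ^ 2)) = (2 * x ^ 2) * Real.exp (-(2 * x ^ 2)) / 2 := by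
        ring
      have hπ3 : 0 ≤ π ^ 3 := by positivity
      have hπ2 : 0 ≤ π ^ 2 := by positivity
      calc (2 * π ^ 3 * x ^ 5 + 7 * π ^ 2 * x ^ 3 + 3 * π * x) * x * Real.exp (-(2 * x ^ 2))
          = 2 * π ^ 3 * (x ^ 5 * x * Real.exp (-(2 * x ^ 2)))
            + 7 * π ^ 2 * (x ^ 3 * x * Real.exp (-(2 * x ^ 2)))
            + 3 * π * (x * x * Real.exp (-(2 * x ^ 2))) := by ring
        _ = 2 * π ^ 3 * ((2 * x ^ 2) ^ 3 * Real.exp (-(2 * x ^ 2)) / 8)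
            + 7 * π ^ 2 * ((2 * x ^ 2) ^ 2 * Real.exp (-(2 * x ^ 2)) / 4)
            + 3 * π * ((2 * x ^ 2) * Real.exp (-(2 * x ^ 2)) / 2) := by rw [e6, e4, e2]
        _ ≤ 2 * π ^ 3 * (6 / 8) + 7 * π ^ 2 * (2 / 4) + 3 * π * (1 / 2) := by
            have a1 : (2 * x ^ 2) ^ 3 * Real.exp (-(2 * x ^ 2)) / 8 ≤ 6 / 8 := by linarith [hu3]
            have a2 : (2 * x ^ 2) ^ 2 * Real.exp (-(2 * x ^ 2)) / 4 ≤ 2 / 4 := by linarith [hu.2]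
            have a3 : (2 * x ^ 2) * Real.exp (-(2 * x ^ 2)) / 2 ≤ 1 / 2 := by linarith [hu.1]
            have b1 := mul_le_mul_of_nonneg_left a1 (by positivity : (0 : ℝ) ≤ 2 * π ^ 3)
            have b2 := mul_le_mul_of_nonneg_left a2 (by positivity : (0 : ℝ) ≤ 7 * π ^ 2)
            have b3 := mul_le_mul_of_nonneg_left a3 (by positivity : (0 : ℝ) ≤ 3 * π)
            linarith
        _ = T₀ := by rw [hT₀def]; ring
    have hex0 : 0 < Real.exp (-x ^ 2) := Real.exp_pos _
    calc |connesHermiteH' x| * x ^ c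
        ≤ (2 * π ^ 3 * x ^ 5 + 7 * π ^ 2 * x ^ 3 + 3 * π * x) * Real.exp (-(π * x ^ 2)) * x :=
          mul_le_mul habs hxc hxc0 (by positivity)
      _ ≤ (2 * π ^ 3 * x ^ 5 + 7 * π ^ 2 * x ^ 3 + 3 * π * x)
            * (Real.exp (-(2 * x ^ 2)) * Real.exp (-x ^ 2)) * x := by
          have hp : 0 ≤ 2 * π ^ 3 * x ^ 5 + 7 * π ^ 2 * x ^ 3 + 3 * π * x := by positivity
          exact mul_le_mul_of_nonneg_right (mul_le_mul_of_nonneg_left hsplit hp) hx0.le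
      _ = ((2 * π ^ 3 * x ^ 5 + 7 * π ^ 2 * x ^ 3 + 3 * π * x) * x * Real.exp (-(2 * x ^ 2)))
            * Real.exp (-x ^ 2) := by ring
      _ ≤ T₀ * Real.exp (-x ^ 2) := mul_le_mul_of_nonneg_right hpoly hex0.le
      _ = T₀ * (1 * Real.exp (-x ^ 2)) := by ring
      _ ≤ T₀ * (x * Real.exp (-x ^ 2)) :=
          mul_le_mul_of_nonneg_left (mul_le_mul_of_nonneg_right hx1 hex0.le) hT₀
  -- integrate the majorant
  have ii : IntervalIntegrable (fun x ↦ |connesHermiteH' x| * x ^ c) volume lam b :=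
    ((continuous_connesHermiteH'.abs).mul (Real.continuous_rpow_const hc.le)).intervalIntegrable _ _
  have im : IntervalIntegrable (fun x ↦ T₀ * (x * Real.exp (-x ^ 2))) volume lam b :=
    (by fun_prop : Continuous fun x ↦ T₀ * (x * Real.exp (-x ^ 2))).intervalIntegrable _ _
  have hanti : ∫ x in lam..b, x * Real.exp (-x ^ 2)
      = (Real.exp (-lam ^ 2) - Real.exp (-b ^ 2)) / 2 := by
    have hd : ∀ x ∈ uIcc lam b,
        HasDerivAt (fun y ↦ -(1 / 2) * Real.exp (-y ^ 2)) (x * Real.exp (-x ^ 2)) x := by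
      intro x _
      have h2 : HasDerivAt (fun y : ℝ ↦ -y ^ 2) (-(2 * x)) x := by
        simpa using (hasDerivAt_pow 2 x).const_mul (-1 : ℝ)
      have h3 := h2.exp.const_mul (-(1 / 2) : ℝ)
      have e : -(1 / 2) * (Real.exp (-x ^ 2) * -(2 * x)) = x * Real.exp (-x ^ 2) := by ring
      rw [e] at h3
      exact h3
    rw [intervalIntegral.integral_eq_sub_of_hasDerivAt hd
      ((by fun_prop : Continuous fun x ↦ x * Real.exp (-x ^ 2)).intervalIntegrable _ _)]
    ring
  have hl2e : Real.exp (-lam ^ 2) ≤ 1 / lam ^ 2 := by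
    have h := (mul_exp_neg_le (by positivity : (0 : ℝ) ≤ lam ^ 2)).1
    rw [le_div_iff₀ hl2]
    linarith
  calc (∫ x in lam..b, |connesHermiteH' x| * x ^ c)
      ≤ ∫ x in lam..b, T₀ * (x * Real.exp (-x ^ 2)) := intervalIntegral.integral_mono_on hb ii im hpt
    _ = T₀ * ((Real.exp (-lam ^ 2) - Real.exp (-b ^ 2)) / 2) := by
        rw [intervalIntegral.integral_const_mul, hanti]
    _ ≤ T₀ * ((1 / lam ^ 2) / 2) := by
        refine mul_le_mul_of_nonneg_left ?_ hT₀
        have := Real.exp_pos (-b ^ 2)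
        linarith
    _ = T₀ / (2 * lam ^ 2) := by
        field_simp

/-- `1/λ² ≤ λ^{−c}` for `λ ≥ 1` and `c ≤ 2`. [folklore] -/
theorem one_div_sq_le_rpow_neg {lam c : ℝ} (hlam1 : 1 ≤ lam) (hc : c ≤ 2) :
    1 / lam ^ 2 ≤ lam ^ (-c) := by
  have hlam0 : 0 < lam := by linarith
  rw [Real.rpow_neg hlam0.le, one_div]
  have h : lam ^ c ≤ lam ^ (2 : ℝ) := Real.rpow_le_rpow_of_exponent_le hlam1 hc
  rw [Real.rpow_two] at h
  exact inv_anti₀ (Real.rpow_pos_of_pos hlam0 c) h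

set_option maxHeartbeats 800000 in
/-- **Connes' Fact 6.4 with the printed rate, from the two rate packages.**  If for `n = 0, 4`
`λ|h_{n,λ}(λ)|`, `∫_0^λ|h_{n,λ} − h_n|`, `∫_0^λ|h_{n,λ}′ − h_n′|(1+x)` are `O(λ^{-2})` uniformly over
the prolate functions, then for `0 ≤ α₀ < ½` there are `C, Λ` with
`‖4M_λ(s) − ξ(½+s)‖ ≤ C·λ^{−(½+Re s)}` for all `λ ≥ Λ`, all prolate `h_{0,λ}, h_{4,λ}` and all
`|Re s| ≤ α₀` — the rate `O(λ^{−1/2−α})`, `α = Re s`, printed in CCM25 (proof of Lemma 7.3).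
[cite: ConnesConsaniMoscovici2025, Lemma 7.3; Connes2026Letter, §6.4 Fact 6.4] -/
theorem prolateGuess_rate_of_w11Rate
    (R0 : ∃ K Λ : ℝ, ∀ lam : ℝ, Λ ≤ lam → ∀ f : ℝ → ℝ, IsProlateFunction lam 0 f →
      lam * |f lam| ≤ K / lam ^ 2 ∧ (∫ x in (0 : ℝ)..lam, |f x - hermiteH0 x|) ≤ K / lam ^ 2 ∧
        (∫ x in (0 : ℝ)..lam, |deriv f x - hermiteH0' x| * (1 + x)) ≤ K / lam ^ 2)
    (R4 : ∃ K Λ : ℝ, ∀ lam : ℝ, Λ ≤ lam → ∀ f : ℝ → ℝ, IsProlateFunction lam 4 f →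
      lam * |f lam| ≤ K / lam ^ 2 ∧ (∫ x in (0 : ℝ)..lam, |f x - hermiteH4 x|) ≤ K / lam ^ 2 ∧
        (∫ x in (0 : ℝ)..lam, |deriv f x - hermiteH4' x| * (1 + x)) ≤ K / lam ^ 2) :
    ∀ α₀ : ℝ, 0 ≤ α₀ → α₀ < 1 / 2 → ∃ C Λ : ℝ, ∀ lam : ℝ, Λ ≤ lam → ∀ f0 f4 : ℝ → ℝ,
      IsProlateFunction lam 0 f0 → IsProlateFunction lam 4 f4 → ∀ s : ℂ, |s.re| ≤ α₀ →
        ‖4 * prolateGuessMellin lam f0 f4 s - riemannXi (1 / 2 + s)‖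
          ≤ C * lam ^ (-(1 / 2 + s.re)) := by
  intro α₀ hα hα'
  obtain ⟨K, Λ, hK0, hK⟩ := prolateGuessH_rate R0 R4
  have ha : 0 < 1 / 2 - α₀ := by linarith
  have hπ := Real.pi_gt_three
  set I₁ := ∫ x in Ioi (0 : ℝ), |connesHermiteH' x| with hI₁def
  have hI₁ : 0 ≤ I₁ := setIntegral_nonneg measurableSet_Ioi fun x _ ↦ abs_nonneg _
  set T₀ : ℝ := 3 * π ^ 3 / 2 + 7 * π ^ 2 / 2 + 3 * π / 2 with hT₀def
  have hT₀ : 0 ≤ T₀ := by positivity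
  refine ⟨4 * (2 / (1 / 2 - α₀)) * (K + K + T₀ / 2) + 4 * (K + 2 * (K + I₁)) / (1 / 2 - α₀),
    max Λ 1, fun lam hlam f0 f4 h0 h4 s hs ↦ ?_⟩
  obtain ⟨hlΛ, hlam1⟩ := max_le_iff.1 hlam
  have hlam0 : 0 < lam := by linarith
  have hl2 : 0 < lam ^ 2 := by positivity
  have hl21 : 1 ≤ lam ^ 2 := by nlinarith only [hlam1]
  obtain ⟨hs1, hs2⟩ := abs_le.1 hs
  have hσlt : |s.re| < 1 / 2 := lt_of_le_of_lt hs hα'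
  have hb : 0 < s.re + 1 / 2 := by linarith
  have hb1 : s.re + 1 / 2 ≤ 1 := by linarith
  have hbσ : 1 / 2 - α₀ ≤ s.re + 1 / 2 := by linarith
  have hbσ' : 1 / 2 - α₀ ≤ 1 / 2 - s.re := by linarith
  obtain ⟨hE, hW⟩ := hK lam hlΛ f0 f4 h0 h4
  -- `M`, `V`
  obtain ⟨⟨L, hL⟩, -⟩ := prolateGuessH_lipschitz_support h0 h4
  obtain ⟨hd, hdi⟩ := prolateGuessH_hasDerivAt h0 h4
  set D := ∫ x in (0 : ℝ)..lam, |deriv (prolateGuessH lam f0 f4) x| with hDdef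
  have hM : ∀ t ∈ Icc 0 lam, |prolateGuessH lam f0 f4 t| ≤ |prolateGuessH lam f0 f4 lam| + D :=
    fun t ht ↦ abs_le_abs_add_integral_abs_deriv hlam0.le hL.continuousOn hd hdi ht
  have hV : (eVariationOn (prolateGuessH lam f0 f4) (Icc 0 lam)).toReal ≤ D :=
    toReal_eVariationOn_Icc_le_integral_abs_deriv hlam0.le hL.continuousOn hd hdi
  have main := norm_four_mul_prolateGuessMellin_sub_riemannXi_le_explicit_of_even h0 h4 hM hσlt
  -- the power `P = λ^{−(½+σ)}`
  set P : ℝ := lam ^ (-(1 / 2 + s.re)) with hPdef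
  have hP0 : 0 ≤ P := Real.rpow_nonneg hlam0.le _
  have hPe : lam ^ (-(s.re + 1 / 2)) = P := by rw [hPdef, add_comm]
  have hP2 : 1 / lam ^ 2 ≤ P := one_div_sq_le_rpow_neg hlam1 (by linarith)
  have hKP : K / lam ^ 2 ≤ K * P := by
    calc K / lam ^ 2 = K * (1 / lam ^ 2) := by ring
      _ ≤ K * P := mul_le_mul_of_nonneg_left hP2 hK0
  -- integrability bookkeeping on `[0, λ]`
  have ih : IntervalIntegrable (fun x ↦ |connesHermiteH' x|) volume 0 lam :=
    (continuous_connesHermiteH'.intervalIntegrable 0 lam).abs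
  have i_diff : IntervalIntegrable
      (fun x ↦ |deriv (prolateGuessH lam f0 f4) x - connesHermiteH' x|) volume 0 lam :=
    (hdi.sub (continuous_connesHermiteH'.intervalIntegrable 0 lam)).abs
  have i_W : IntervalIntegrable
      (fun x ↦ |deriv (prolateGuessH lam f0 f4) x - connesHermiteH' x| * (1 + x)) volume 0 lam :=
    i_diff.mul_continuousOn (by fun_prop)
  have i_b : IntervalIntegrable
      (fun x ↦ |deriv (prolateGuessH lam f0 f4) x - connesHermiteH' x| * x ^ (s.re + 1 / 2))
        volume 0 lam :=
    i_diff.mul_continuousOn (Real.continuous_rpow_const hb.le).continuousOn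
  have rpow_le : ∀ {x e : ℝ}, 0 ≤ x → 0 ≤ e → e ≤ 1 → x ^ e ≤ 1 + x := by
    intro x e hx he₀ he₁
    rcases le_or_gt x 1 with h | h
    · exact (Real.rpow_le_one hx h he₀).trans (by linarith)
    · exact (Real.rpow_le_self_of_one_le h.le he₁).trans (by linarith)
  -- (1) end-point term
  have t1 : |prolateGuessH lam f0 f4 lam| * lam ^ (s.re + 1 / 2) ≤ K / lam ^ 2 := by
    have h1 : lam ^ (s.re + 1 / 2) ≤ lam := Real.rpow_le_self_of_one_le hlam1 hb1
    exact (mul_le_mul_of_nonneg_left h1 (abs_nonneg _)).trans hE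
  -- (2) weighted derivative term
  have t2 : (∫ x in (0 : ℝ)..lam,
      |deriv (prolateGuessH lam f0 f4) x - connesHermiteH' x| * x ^ (s.re + 1 / 2)) ≤ K / lam ^ 2 := by
    refine le_trans ?_ hW
    refine intervalIntegral.integral_mono_on hlam0.le i_b i_W (fun x hx ↦ ?_)
    exact mul_le_mul_of_nonneg_left (rpow_le hx.1 hb.le hb1) (abs_nonneg _)
  -- (3) Gaussian tail
  have t3 : (∫ x in Ioi lam, |connesHermiteH' x| * x ^ (s.re + 1 / 2)) ≤ T₀ / (2 * lam ^ 2) :=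
    integral_Ioi_abs_connesHermiteH'_mul_rpow_le hb hb1 hlam1
  have t3' : T₀ / (2 * lam ^ 2) = (T₀ / 2) / lam ^ 2 := by
    rw [div_div]
  -- (4) `D ≤ K + I₁`, `|h_λ(λ)| ≤ K`
  have hD : D ≤ K + I₁ := by
    have step1 : D ≤ ∫ x in (0 : ℝ)..lam,
          (|deriv (prolateGuessH lam f0 f4) x - connesHermiteH' x| * (1 + x)
            + |connesHermiteH' x|) := by
      refine intervalIntegral.integral_mono_on hlam0.le hdi.abs (i_W.add ih) (fun x hx ↦ ?_)
      have hx0 : 0 ≤ x := hx.1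
      have hd0 : 0 ≤ |deriv (prolateGuessH lam f0 f4) x - connesHermiteH' x| := abs_nonneg _
      calc |deriv (prolateGuessH lam f0 f4) x|
          = |(deriv (prolateGuessH lam f0 f4) x - connesHermiteH' x) + connesHermiteH' x| := by
            ring_nf
        _ ≤ |deriv (prolateGuessH lam f0 f4) x - connesHermiteH' x| + |connesHermiteH' x| :=
            abs_add_le _ _
        _ ≤ |deriv (prolateGuessH lam f0 f4) x - connesHermiteH' x| * (1 + x)
              + |connesHermiteH' x| := by
            have := le_mul_of_one_le_right hd0 (show (1 : ℝ) ≤ 1 + x by linarith only [hx0])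
            linarith only [this]
    have step2 : (∫ x in (0 : ℝ)..lam,
          (|deriv (prolateGuessH lam f0 f4) x - connesHermiteH' x| * (1 + x)
            + |connesHermiteH' x|))
        = (∫ x in (0 : ℝ)..lam,
            |deriv (prolateGuessH lam f0 f4) x - connesHermiteH' x| * (1 + x))
          + ∫ x in (0 : ℝ)..lam, |connesHermiteH' x| :=
      intervalIntegral.integral_add i_W ih
    have step3 : (∫ x in (0 : ℝ)..lam, |connesHermiteH' x|) ≤ I₁ := by
      rw [intervalIntegral.integral_of_le hlam0.le]
      exact setIntegral_mono_set integrableOn_abs_connesHermiteH'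
        (ae_of_all _ fun x ↦ abs_nonneg _) Ioc_subset_Ioi_self.eventuallyLE
    have step4 : K / lam ^ 2 ≤ K := div_le_self hK0 hl21
    linarith only [step1, step2, step3, step4, hW]
  have hHlam : |prolateGuessH lam f0 f4 lam| ≤ K := by
    have h0' : 0 ≤ |prolateGuessH lam f0 f4 lam| := abs_nonneg _
    have h1 : |prolateGuessH lam f0 f4 lam| ≤ |prolateGuessH lam f0 f4 lam| * lam :=
      le_mul_of_one_le_right h0' hlam1
    have h2 : K / lam ^ 2 ≤ K := div_le_self hK0 hl21
    linarith only [h1, h2, hE]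
  -- assemble the main term
  have hfac : 1 / (1 / 2 - s.re) + 1 / (1 / 2 + s.re) ≤ 2 / (1 / 2 - α₀) := by
    have e1 : 1 / (1 / 2 - s.re) ≤ 1 / (1 / 2 - α₀) := one_div_le_one_div_of_le ha hbσ'
    have e2 : 1 / (1 / 2 + s.re) ≤ 1 / (1 / 2 - α₀) :=
      one_div_le_one_div_of_le ha (by linarith)
    have : 2 / (1 / 2 - α₀) = 1 / (1 / 2 - α₀) + 1 / (1 / 2 - α₀) := by ring
    linarith
  have hfac0 : 0 ≤ 1 / (1 / 2 - s.re) + 1 / (1 / 2 + s.re) := by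
    have h1 : 0 < 1 / 2 - s.re := by linarith
    have h2 : 0 < 1 / 2 + s.re := by linarith
    have e1 := one_div_pos.2 h1
    have e2 := one_div_pos.2 h2
    linarith only [e1, e2]
  have hbr : |prolateGuessH lam f0 f4 lam| * lam ^ (s.re + 1 / 2)
        + (∫ x in (0 : ℝ)..lam,
            |deriv (prolateGuessH lam f0 f4) x - connesHermiteH' x| * x ^ (s.re + 1 / 2))
        + (∫ x in Ioi lam, |connesHermiteH' x| * x ^ (s.re + 1 / 2))
      ≤ (K + K + T₀ / 2) * P := by
    have hsum : |prolateGuessH lam f0 f4 lam| * lam ^ (s.re + 1 / 2)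
          + (∫ x in (0 : ℝ)..lam,
              |deriv (prolateGuessH lam f0 f4) x - connesHermiteH' x| * x ^ (s.re + 1 / 2))
          + (∫ x in Ioi lam, |connesHermiteH' x| * x ^ (s.re + 1 / 2))
        ≤ (K + K + T₀ / 2) / lam ^ 2 := by
      rw [add_div, add_div, ← t3']
      linarith
    have h2 : (K + K + T₀ / 2) / lam ^ 2 ≤ (K + K + T₀ / 2) * P := by
      calc (K + K + T₀ / 2) / lam ^ 2 = (K + K + T₀ / 2) * (1 / lam ^ 2) := by ring
        _ ≤ (K + K + T₀ / 2) * P :=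
            mul_le_mul_of_nonneg_left hP2 (by positivity : (0 : ℝ) ≤ K + K + T₀ / 2)
    linarith
  have hbr0 : 0 ≤ |prolateGuessH lam f0 f4 lam| * lam ^ (s.re + 1 / 2)
        + (∫ x in (0 : ℝ)..lam,
            |deriv (prolateGuessH lam f0 f4) x - connesHermiteH' x| * x ^ (s.re + 1 / 2))
        + (∫ x in Ioi lam, |connesHermiteH' x| * x ^ (s.re + 1 / 2)) := by
    have a1 : 0 ≤ |prolateGuessH lam f0 f4 lam| * lam ^ (s.re + 1 / 2) := by positivity
    have a2 : 0 ≤ ∫ x in (0 : ℝ)..lam,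
        |deriv (prolateGuessH lam f0 f4) x - connesHermiteH' x| * x ^ (s.re + 1 / 2) :=
      intervalIntegral.integral_nonneg hlam0.le fun x hx ↦
        mul_nonneg (abs_nonneg _) (Real.rpow_nonneg hx.1 _)
    have a3 : 0 ≤ ∫ x in Ioi lam, |connesHermiteH' x| * x ^ (s.re + 1 / 2) :=
      setIntegral_nonneg measurableSet_Ioi fun x hx ↦
        mul_nonneg (abs_nonneg _) (Real.rpow_nonneg (by
          have : lam < x := hx
          linarith) _)
    linarith
  have hmainterm : 4 * ((1 / (1 / 2 - s.re) + 1 / (1 / 2 + s.re)) *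
        (|prolateGuessH lam f0 f4 lam| * lam ^ (s.re + 1 / 2)
          + (∫ x in (0 : ℝ)..lam,
              |deriv (prolateGuessH lam f0 f4) x - connesHermiteH' x| * x ^ (s.re + 1 / 2))
          + ∫ x in Ioi lam, |connesHermiteH' x| * x ^ (s.re + 1 / 2)))
      ≤ 4 * (2 / (1 / 2 - α₀)) * (K + K + T₀ / 2) * P := by
    have := mul_le_mul hfac hbr hbr0 (by positivity)
    calc _ ≤ 4 * (2 / (1 / 2 - α₀) * ((K + K + T₀ / 2) * P)) :=
          mul_le_mul_of_nonneg_left this (by norm_num)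
      _ = _ := by ring
  -- the boundary term
  have hVM : (eVariationOn (prolateGuessH lam f0 f4) (Icc 0 lam)).toReal
        + (|prolateGuessH lam f0 f4 lam| + D) ≤ K + 2 * (K + I₁) := by linarith
  have hVM0 : 0 ≤ (eVariationOn (prolateGuessH lam f0 f4) (Icc 0 lam)).toReal
        + (|prolateGuessH lam f0 f4 lam| + D) := by
    have : 0 ≤ D := intervalIntegral.integral_nonneg hlam0.le fun _ _ ↦ abs_nonneg _
    positivity
  have hbdry : 4 * (((eVariationOn (prolateGuessH lam f0 f4) (Icc 0 lam)).toReal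
        + (|prolateGuessH lam f0 f4 lam| + D)) * lam ^ (-(s.re + 1 / 2)) / (s.re + 1 / 2))
      ≤ 4 * (K + 2 * (K + I₁)) / (1 / 2 - α₀) * P := by
    rw [hPe]
    have s1 : ((eVariationOn (prolateGuessH lam f0 f4) (Icc 0 lam)).toReal
          + (|prolateGuessH lam f0 f4 lam| + D)) * P ≤ (K + 2 * (K + I₁)) * P :=
      mul_le_mul_of_nonneg_right hVM hP0
    have s2 : ((eVariationOn (prolateGuessH lam f0 f4) (Icc 0 lam)).toReal
          + (|prolateGuessH lam f0 f4 lam| + D)) * P / (s.re + 1 / 2)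
        ≤ (K + 2 * (K + I₁)) * P / (s.re + 1 / 2) := div_le_div_of_nonneg_right s1 hb.le
    have s3 : (K + 2 * (K + I₁)) * P / (s.re + 1 / 2) ≤ (K + 2 * (K + I₁)) * P / (1 / 2 - α₀) :=
      div_le_div_of_nonneg_left (by positivity) ha hbσ
    have s4 : 4 * (K + 2 * (K + I₁)) / (1 / 2 - α₀) * P
        = 4 * ((K + 2 * (K + I₁)) * P / (1 / 2 - α₀)) := by ring
    rw [s4]
    linarith
  calc ‖4 * prolateGuessMellin lam f0 f4 s - riemannXi (1 / 2 + s)‖ ≤ _ := main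
    _ ≤ 4 * (2 / (1 / 2 - α₀)) * (K + K + T₀ / 2) * P + 4 * (K + 2 * (K + I₁)) / (1 / 2 - α₀) * P :=
        add_le_add hmainterm hbdry
    _ = (4 * (2 / (1 / 2 - α₀)) * (K + K + T₀ / 2) + 4 * (K + 2 * (K + I₁)) / (1 / 2 - α₀)) * P := by
        ring

/-- The uniform form of the rate on the closed substrip: `‖4M_λ(s) − ξ(½+s)‖ ≤ C·λ^{−(½−α₀)}` for
`λ ≥ Λ`, all prolate `h_{0,λ}, h_{4,λ}` and all `|Re s| ≤ α₀` (`λ^{−(½+Re s)} ≤ λ^{−(½−α₀)}`).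
[cite: ConnesConsaniMoscovici2025, Lemma 7.3; Connes2026Letter, §6.4 Fact 6.4] -/
theorem prolateGuess_rate_uniform_of_rate
    (hR : ∀ α₀ : ℝ, 0 ≤ α₀ → α₀ < 1 / 2 → ∃ C Λ : ℝ, ∀ lam : ℝ, Λ ≤ lam → ∀ f0 f4 : ℝ → ℝ,
      IsProlateFunction lam 0 f0 → IsProlateFunction lam 4 f4 → ∀ s : ℂ, |s.re| ≤ α₀ →
        ‖4 * prolateGuessMellin lam f0 f4 s - riemannXi (1 / 2 + s)‖
          ≤ C * lam ^ (-(1 / 2 + s.re))) :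
    ∀ α₀ : ℝ, 0 ≤ α₀ → α₀ < 1 / 2 → ∃ C Λ : ℝ, 0 ≤ C ∧ ∀ lam : ℝ, Λ ≤ lam → ∀ f0 f4 : ℝ → ℝ,
      IsProlateFunction lam 0 f0 → IsProlateFunction lam 4 f4 → ∀ s : ℂ, |s.re| ≤ α₀ →
        ‖4 * prolateGuessMellin lam f0 f4 s - riemannXi (1 / 2 + s)‖
          ≤ C * lam ^ (-(1 / 2 - α₀)) := by
  intro α₀ hα hα'
  obtain ⟨C, Λ, hC⟩ := hR α₀ hα hα'
  refine ⟨max C 0, max Λ 1, le_max_right _ _, fun lam hlam f0 f4 h0 h4 s hs ↦ ?_⟩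
  obtain ⟨hlΛ, hlam1⟩ := max_le_iff.1 hlam
  have hlam0 : 0 < lam := by linarith
  obtain ⟨hs1, hs2⟩ := abs_le.1 hs
  have h := hC lam hlΛ f0 f4 h0 h4 s hs
  have hP0 : 0 ≤ lam ^ (-(1 / 2 + s.re)) := Real.rpow_nonneg hlam0.le _
  have hPP : lam ^ (-(1 / 2 + s.re)) ≤ lam ^ (-(1 / 2 - α₀)) :=
    Real.rpow_le_rpow_of_exponent_le hlam1 (by linarith)
  calc _ ≤ C * lam ^ (-(1 / 2 + s.re)) := h
    _ ≤ max C 0 * lam ^ (-(1 / 2 + s.re)) := mul_le_mul_of_nonneg_right (le_max_left _ _) hP0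
    _ ≤ max C 0 * lam ^ (-(1 / 2 - α₀)) := mul_le_mul_of_nonneg_left hPP (le_max_right _ _)

/-- A uniform power rate implies the qualitative statement `prolateGuess_tendsto_riemannXi`
(`λ^{−(½−α₀)} → 0`). [cite: Connes2026Letter, §6.4 Fact 6.4] -/
theorem prolateGuess_tendsto_riemannXi_of_rate_uniform
    (hU : ∀ α₀ : ℝ, 0 ≤ α₀ → α₀ < 1 / 2 → ∃ C Λ : ℝ, 0 ≤ C ∧ ∀ lam : ℝ, Λ ≤ lam →
      ∀ f0 f4 : ℝ → ℝ, IsProlateFunction lam 0 f0 → IsProlateFunction lam 4 f4 →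
        ∀ s : ℂ, |s.re| ≤ α₀ →
          ‖4 * prolateGuessMellin lam f0 f4 s - riemannXi (1 / 2 + s)‖
            ≤ C * lam ^ (-(1 / 2 - α₀))) :
    prolateGuess_tendsto_riemannXi := by
  intro α₀ hα hα' ε hε
  obtain ⟨C, Λ, hC0, hC⟩ := hU α₀ hα hα'
  have ha : 0 < 1 / 2 - α₀ := by linarith
  have E1 : ∀ᶠ lam : ℝ in atTop, lam ^ (-(1 / 2 - α₀)) < ε / (C + 1) :=
    (tendsto_rpow_neg_atTop ha).eventually (gt_mem_nhds (by positivity))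
  obtain ⟨Λ', hΛ'⟩ := eventually_atTop.1 ((eventually_ge_atTop Λ).and E1)
  refine ⟨Λ', fun lam hlam f0 f4 h0 h4 s hs ↦ ?_⟩
  obtain ⟨hlΛ, hP⟩ := hΛ' lam hlam
  have hlam0 : 0 < lam := h0.lam_pos
  have hP0 : 0 ≤ lam ^ (-(1 / 2 - α₀)) := Real.rpow_nonneg hlam0.le _
  have h := hC lam hlΛ f0 f4 h0 h4 s hs
  have h2 : C * lam ^ (-(1 / 2 - α₀)) ≤ C * (ε / (C + 1)) := mul_le_mul_of_nonneg_left hP.le hC0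
  have h3 : C * (ε / (C + 1)) ≤ ε := by
    rw [mul_div_assoc', div_le_iff₀ (by positivity : (0 : ℝ) < C + 1)]
    nlinarith only [hε, hC0]
  linarith only [h, h2, h3]

/-- **Connes' Fact 6.4 = CCM25 Lemma 7.3 with its printed rate**, unconditionally: for every
`0 ≤ α₀ < ½` there are `C, Λ` such that for all `λ ≥ Λ`, all prolate functions `h_{0,λ}, h_{4,λ}`
defining the guess `h_λ`, and all `s` with `|Re s| ≤ α₀`,
`‖4M_λ(s) − ξ(½+s)‖ ≤ C·λ^{−(½+Re s)}` (the `O(λ^{−1/2−α})`, `α = Re s`, of CCM25 p. 32).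
All ingredients are proved in the tree: the `O(λ^{-2})` sup-norm prolate → Hermite rate
(`ProlateSupNormRate`), the weighted `W^{1,1}` rate derived from it here by a barrier argument on the
forbidden region, Müntz's formula in the strip and Titchmarsh's bound for `ζ(w)/w`
(`ConnesProlateGuessError`).  No RH anywhere; this is NOT an RH statement.
[cite: ConnesConsaniMoscovici2025, Lemma 7.3; Connes2026Letter, §6.4 Fact 6.4] -/
theorem prolateGuess_rate :
    ∀ α₀ : ℝ, 0 ≤ α₀ → α₀ < 1 / 2 → ∃ C Λ : ℝ, ∀ lam : ℝ, Λ ≤ lam → ∀ f0 f4 : ℝ → ℝ,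
      IsProlateFunction lam 0 f0 → IsProlateFunction lam 4 f4 → ∀ s : ℂ, |s.re| ≤ α₀ →
        ‖4 * prolateGuessMellin lam f0 f4 s - riemannXi (1 / 2 + s)‖
          ≤ C * lam ^ (-(1 / 2 + s.re)) :=
  prolateGuess_rate_of_w11Rate w11Rate_zero w11Rate_four

/-- The uniform rate on closed substrips: `sup_{|Re s| ≤ α₀} ‖4M_λ(s) − ξ(½+s)‖ ≤ C·λ^{−(½−α₀)}`
for `λ ≥ Λ`, unconditionally. [cite: ConnesConsaniMoscovici2025, Lemma 7.3;
Connes2026Letter, §6.4 Fact 6.4] -/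
theorem prolateGuess_rate_uniform :
    ∀ α₀ : ℝ, 0 ≤ α₀ → α₀ < 1 / 2 → ∃ C Λ : ℝ, 0 ≤ C ∧ ∀ lam : ℝ, Λ ≤ lam → ∀ f0 f4 : ℝ → ℝ,
      IsProlateFunction lam 0 f0 → IsProlateFunction lam 4 f4 → ∀ s : ℂ, |s.re| ≤ α₀ →
        ‖4 * prolateGuessMellin lam f0 f4 s - riemannXi (1 / 2 + s)‖
          ≤ C * lam ^ (-(1 / 2 - α₀)) :=
  prolateGuess_rate_uniform_of_rate prolateGuess_rate

/-- Third in-tree proof of the landed qualitative statement `prolateGuess_tendsto_riemannXi`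
(Connes' Fact 6.4), now through the rate. -/
example : prolateGuess_tendsto_riemannXi :=
  prolateGuess_tendsto_riemannXi_of_rate_uniform prolateGuess_rate_uniform

end Literature.NumberTheory.LFunctions
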